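import Summits.QuantumFields.YangMills.Theorems.BalabanUVNodesN15CurvedGluingSmoothCutDressedGluedDefectGaugedUNTwisted
import Summits.QuantumFields.YangMills.Theorems.BalabanUVNodesN15PerCubeGreenTwoGridKnitSmall
import Summits.QuantumFields.YangMills.Theorems.BalabanUVNodesN15PerCubeGreenTwoGridSiteFits
import Summits.QuantumFields.YangMills.Theorems.BalabanUVNodesN15PerCubeGreenTwoGridCutRows
import Summits.QuantumFields.YangMills.Theorems.BalabanUVNodesN15PerCubeGreenTwoGridNonlocalRow
import Summits.QuantumFields.YangMills.Theorems.BalabanUVNodesN15CommutatorOutputSupport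
import Summits.QuantumFields.YangMills.Theorems.BalabanUVNodesN15CovariantTwoGridPullbackTwistDataUN
import Summits.QuantumFields.YangMills.Theorems.BalabanUVNodesN15CovariantLandauFlatRowsAllKing
import Summits.QuantumFields.YangMills.Theorems.BalabanUVNodesN15TwoSpacingGluingCutRowsMargin
import HarnessLib

/-!
# N15 = NE2, road (c) — PROGRAMME (PC) «[B9] Sect. C FOR THE LANDAU LETTER WITH PER-CUBE GAUGES (3.35) AS PRINTED», (PC-E) (C5): ★★★ THE TWO-GRID η-DEFECT OF THE SCALAR
# COVARIANT GREEN's FUNCTION KNIT WITH PER-CUBE GAUGES, THROUGH THE COVARIANT (TWISTED) TRANSPORT — n15-c∕335 INSTANTIATED ON THE (PC) SITE CARRIERS OF BOTH GRIDS: every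
# one of 335's rows DISCHARGED BY NAME but the displayed gauge-group data, the (3.35) column letter `ρ` of the transformed fine bond variables on the plateau cubes and the
# locality row of Bałaban's summand `P` (dag-n15-c g32, n15-c∕339)

Cell `pub-ymgap`, seat `pub-ymgap-dag-n15-c` (generation g32; R134 (a) seat, strategy s1 «first missing estimate»; HUMAN RULING D-0062; chair R424 venue).
`bears_on: R4∕N15 · K3⁸ SpineGivenEndpointR13SepCoPHV (stmt-QuantumFields-27366)`; filed `--kind proof --supports stmt-QuantumFields-27366 --as helper` — COUNT-NEUTRAL.
ONE theorem, 0 `def`, 0 `sorry`; bookkeeping over landed rows, NO new estimate; `maxHeartbeats 800000` ∕ `maxRecDepth 2048` for the size of 335's terms only (n15-c g15 FILE 123's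
budget; every step is a one-line application).  Imports BY NAME n15-c∕335 `…SmoothCutDressedGluedDefectGaugedUNTwisted` (★★★ `uN_hasMaj_idef_glueInv_smoothCutDressed_localGauges_tr`),
n15-c∕338 `…PerCubeGreenTwoGridKnitSmall` (`cvSmall335`), dag-n15-a ✓p797337 `…PerCubeGreenTwoGridSiteFits` (the sixteen two-grid fit ∕ support ∕ step ∕ tail rows on sites; through
it n15-c∕261′ `…PerCubeGreenFineRows`, n15-c∕261 `…PerCubeGreenRows`), dag-n15-a ✓p794216 `…PerCubeGreenTwoGridCutRows` (`hasMaj_idef_cut(F∕B)_scCube`, `liftBlk_scBlk_comp_liftMap_kingPr`;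
through it n15-c∕261b∕261b′ `…PerCubeGreen(Fine)CutRows`), dag-n15-a ✓p794355 `…PerCubeGreenTwoGridNonlocalRow` (`hasMaj_idef_commOp_scQQ_scH_king`), dag-n15-a ✓p796072
`…CommutatorOutputSupport` (`mulOp_comp_commOp_conj_comp_of_support`, `mulOp_one_sub_scPsi_comp_covLapM_comp_mulOp_scH`; through it n15-c∕26x `scPsi_near_scChi`,
`coverMargin_cut_margin`), n15-c∕337 `…CovariantTwoGridPullbackTwistDataUN` (`ctauS_coordMat_Ad_eq_conj`, `abs_kingStairT_coordMat_Ad_transpose_le_one`,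
`smear_cols_kingStairT_coordMat_Ad_transpose_sub_one_le(_kingPr)`; through it dag-n15-a `ctauS`, `kingStairT`, `kingSec`, `blockOf_kingPr`), dag-n15-a Ξ-4 `…CovariantLandauFlatRowsAllKing`
(`flatRowsAll_king`: the flat rows `G′(1)`, `∂G′(1)`, `S̄ₕ∂G′(1)` on BOTH grids and their two-grid defects at King's masses, HYPOTHESIS-FREE), n15-c `…TwoSpacingGluingCutRowsMargin`
(`mulOp_comp_mulOp_comm`).  Nothing in the tree is modified, no landed name re-declared; the generator is HOME `tools/g32/build_C5.py` (the twin of g15 `build123.py` ∕ g26 `buildC.py`).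

THE THEOREM `uN_idef_scGlued_tr`.  For odd `L ≥ 7`, `a₀ > 0` and a colour index `ι` there are `δ, w₀, R₀, θ₀ > 0` and `D` such that on EVERY doubled torus `2L·L^m` of the cover
(`k ≥ 1`, `L^m ≥ w₀`) and EVERY refinement `r ≥ 1`, at King's masses `a_K(a₀,L,k)·(L^k)^{d+1}` (coarse) and `a_K(a₀,L,r+k)·(L^rL^k)^{d+1}` (fine), for trace-form coordinates `e`,
unitary per-cube FINE site gauges `u′_k` (the coarse gauge of cube `k` is the INDUCED `u′_k∘σ`, `σ` = King's section `kingSec`), unitary bond fields `U` (coarse sites), `U′` (fine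
sites), summands `P`, `P′` with the conjugation laws `M_{W_k}PM_{W_kᵀ} = a·Q′ᵀQ′ ⊗ 1 − N_V k` (both grids), the (3.35) letters `r_V` of the transformed bond variables on the cut boxes
and their species fit `o_V` across King's pairing, the cut ∕ far ∕ defect letters `R_N`, `θ_F ≤ θ₀`, `o_N`, `r_D` of `N_V`, `N′_V` (`r_V(1+|J⊕J|) + R_N ≤ R₀`, `o_V(1+|J⊕J|) + o_N ≤ o`),
the (3.35) COLUMN letter `ρ` of `Ad(u′_kU′u′_kᴴ)` on the plateau cube of `k`, and the locality row `M_{1−ψ_k}∘P∘M_{h_k} = 0` of `P`: the η-defect THROUGH THE COVARIANT TRANSPORT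
`τ_{Ad∘U′} = ctauS (Ad∘U′)` (dag-n15-a; [B7] (125): King's pull-back followed by the parallel transport of `U′` along the block staircase) of `scGlued′` (spacing `(L^rL^k)^{−1}`,
gauges `u′_k`) against `scGlued` (spacing `L^{−k}`, gauges `u′_k∘σ`) is `≤ D·((L^k)^{−1∕4} + o + s + r_D)·e^{−(δ∕16)|y−y′|_T}` blockwise, `s = (1+ρ)^{(d+1)(L^r−1)} − 1` the smeared stair
letter — EVERY one of 335's rows DISCHARGED BY NAME (262∕263's dischargers on each grid; the two-grid cut ∕ commutator ∕ tail defects from Ξ-4 rows 9–12, ✓p794216, ✓p794355, ✓p797337;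
the bump ∕ partition fits ✓p797337; the twist slots `hTk hT0 hΨ hSin hSout` from n15-c∕336∕337, `hKout` from ✓p796072; the letter through n15-c∕338 `cvSmall335`) except the DISPLAYED
gauge-group data.  THE CONSTANTS: `δ, C` of Ξ-4 (`β = β₁ = C`, `m₀ = m₁ = C(L^k)^{−1∕4}`), `σ = δ∕32`, `ρ₁ = ρ_T = δ∕2`, `ρ₂ = δ∕4`, `ρ₃ = δ∕8`, `ρ_N = δ − δ∕2`, `δ_V = ρ_F = δ`, `ε = δ∕2`,
tails `ε₀ = r_F = 0` (they VANISH on sites), `r_W = θ_W = 0`, `c_t = c₁ = π∕w`, `c₂ = 32π²∕w²`, `ℓ = ω = π(d+1)∕w`, `c_N = 2π(d+1)∕w·a₀`, `R₀`, `θ₀`, `w₀` as in n15-c∕262.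

HONEST FRAMING ∕ LIMITS.  Bookkeeping: the η-defect of the MODEL glued propagator (dag-n15-w3's smooth-cut dressed random walk over King's doubled-torus cover, local propagators
= the compressed torus Green's functions `G′(1)M_{ψ_k}`) on MODEL carriers, at model level ((PC-E-A) of `PCE-DESIGN-g31.md` §6: the SCALAR covariant Green's function `G′(U)`,
Bałaban's summand `P` and the perturbations `N_V` abstract); the displayed hypotheses are the paper's small-field hypotheses in the CUBE GAUGES ((3.35) on the cut boxes, the column
letter on the plateau cubes, the species fit of PAIRING (i)) and the lane's `P`∕`N_V` letters, whose producers (`Reg335Cube` per box on both grids + the covariant fit — (C6)) are NOT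
here; constants crude and ours.  This is the SHAPE of [B9] Thm 3.14 («G(U) − G(U′) small») for `G′`, NOT the printed theorem; nothing of [B5]∕[B6]∕[B7]∕[B9] asserted.  NE2⁺ NOT
PRINTED, NOT proved; N15 of record untouched (DISCHARGED AS CONSUMED, p687738); K3⁸ OPEN; counts of record UNMOVED (typed 28∕28 · discharged 8∕27); one finite 𝕋⁴ at fixed ε per
index — NOT infinite volume, NOT OS on ℝ⁴, NOT a mass gap, NOT Clay; R4 closes the conditional finite-𝕋⁴ rung `BalabanLadder.UV` only.  Restate-immune (no Theses import).
-/

noncomputable section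

open scoped BigOperators Matrix Matrix.Norms.Frobenius

namespace Summit.QuantumFields.YangMills.BalabanUVNodes.N15.Gluing

open Real
open Literature.MathematicalPhysics.QuantumFieldTheory.Balaban1983to89
open Literature.MathematicalPhysics.QuantumFieldTheory.Balaban1983to89.B5Prop11Plancherel (Tor fine unitVec)
open Literature.MathematicalPhysics.QuantumFieldTheory.Balaban1983to89.B11SectG (BlockNorm HasMaj RowSum hasMaj_zero)
open Literature.MathematicalPhysics.QuantumFieldTheory.Balaban1983to89.B6RandomWalk (Triangle254)
open Literature.MathematicalPhysics.QuantumFieldTheory.Balaban1983to89.T4EtaRateDefect (idef)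
open Literature.MathematicalPhysics.QuantumFieldTheory.Balaban1983to89.T4EtaRateCoeffDefect (pull)
open Literature.MathematicalPhysics.QuantumFieldTheory.Balaban1983to89.B6Prop26Gluing (mulOp mulOp_apply ind ind_nonneg ind_le_one)
open Literature.MathematicalPhysics.QuantumFieldTheory.Balaban1983to89.B6UnitTorusCarrier (unitTorusGeo triangle254_unitTorusGeo rowSum_unitTorusGeo unitTorusGeo_dist_nonneg
  unitTorusGeo_dist_symm unitTorusGeo_dist_self)
open Literature.MathematicalPhysics.QuantumFieldTheory.Balaban1983to89.B5SiteBridgeP12 (MP)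
open Literature.MathematicalPhysics.QuantumFieldTheory.King1986 (aK aK_pos aK_le)
open Literature.MathematicalPhysics.QuantumFieldTheory.King1986.Torus (blockOf tdistT tdistT_nonneg tdistT_symm)
open Literature.Barriers.QuantumFields (traceForm)
open Summit.QuantumFields.YangMills.BalabanUVNodes.N15.BackgroundLayer (fgrad fgradAdj bgrad fgrad_apply fgradAdj_apply bgrad_apply stack projO bgPropV covLapM tCoefA tCoefC unstackM)
open Summit.QuantumFields.YangMills.BalabanUVNodes.N15.VectorPiece (bshiftEquiv bshiftEquiv_apply kingPr kingPrV tensorId tdistT_blockOf_sub_unitVec_le)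
open Summit.QuantumFields.YangMills.BalabanUVNodes.N15.MatrixSpecies (mmulOp coordMat liftBlk liftMap liftEquiv liftEquiv_apply liftEquiv_symm_apply)
open Summit.QuantumFields.YangMills.BalabanUVNodes.N15.TwoGrid (paramsOf chiCube cubeBlocks chiCube_of_not_mem abs_chiCube_le_one)
open Summit.QuantumFields.YangMills.BalabanUVNodes.N15.CurvedSpecies (gaugePair uN_hasMaj_idef_glueInv_smoothCutDressed_localGauges_tr)
open Summit.QuantumFields.YangMills.BalabanUVNodes.N15.CovLandau (cgrad csavg cGreen bBack flatRowsAll_king)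
open Summit.QuantumFields.YangMills.BalabanUVNodes.N15.CovAvg (kingStairT kingSec ctauS blockOf_kingPr ctauS_coordMat_Ad_eq_conj abs_kingStairT_coordMat_Ad_transpose_le_one
  smear_cols_kingStairT_coordMat_Ad_transpose_sub_one_le smear_cols_kingStairT_coordMat_Ad_transpose_sub_one_le_kingPr)

variable {d : ℕ}

/-! ## The two-grid η-defect of the scalar covariant Green's function knit with per-cube gauges, through the covariant transport -/

section Knit

variable {L : ℕ} [NeZero L]

set_option maxHeartbeats 800000 in
set_option maxRecDepth 2048 in
/-- ★★★ **THE TWO-GRID η-DEFECT OF THE SCALAR COVARIANT GREEN's FUNCTION KNIT WITH PER-CUBE GAUGES, THROUGH THE COVARIANT TRANSPORT (n15-c∕335 INSTANTIATED ON SITES).**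
For odd `L ≥ 7`, `a₀ > 0`, a colour index `ι`: there are `δ, w₀, R₀, θ₀ > 0` and `D` such that on every doubled torus `2L·L^m` of the cover (`k ≥ 1`, `L^m ≥ w₀`) and every refinement
`r ≥ 1`, for trace-form coordinates `e`, unitary fine cube gauges `u′_k` (coarse gauges INDUCED, `u′_k∘σ`), unitary bond fields `U`, `U′`, summands `P`, `P′` with the conjugation laws
`M_{W_k}PM_{W_kᵀ} = a·Q′ᵀQ′ ⊗ 1 − N_V k` (both grids), the (3.35) letters `r_V` on the cut boxes and their species fit `o_V` across the pairing, the letters `R_N`, `θ_F ≤ θ₀`, `o_N`,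
`r_D` of `N_V`, `N′_V`, the (3.35) column letter `ρ` of `Ad(u′_kU′u′_kᴴ)` on the plateau cube of `k`, and `M_{1−ψ_k}∘P∘M_{h_k} = 0`: the η-defect through `τ_{Ad∘U′}` of `scGlued′`
against `scGlued` is `≤ D·((L^k)^{−1∕4} + o + ((1+ρ)^{(d+1)(L^r−1)} − 1) + r_D)·e^{−(δ∕16)|y−y′|_T}` blockwise.  Every row of 335 DISCHARGED BY NAME but the displayed gauge-group data.
MODEL carriers; the SHAPE of [B9] Thm 3.14 for `G′`, NOT the printed theorem.
[cite: Balaban1985BackgroundPropagators, Thm 3.14 pp.426–427 (template: «G(U′) − G(U) small»), (3.34)–(3.35) p.396, (3.31)–(3.32) p.395, (3.62)–(3.65) pp.402–403; Balaban1985Averaging, (125) p.36 (the transport: shape);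
Balaban1984PropagatorsII, (2.133)–(2.136) p.247; King1986, p.664 (pairing)] -/
theorem uN_idef_scGlued_tr (hL : Odd L ∧ 1 < L) (hL7 : 7 ≤ L) {a₀ : ℝ} (ha₀ : 0 < a₀) (ι : Type) [Fintype ι] [DecidableEq ι] :
    ∃ δ w₀ R₀ θ₀ D : ℝ, 0 < δ ∧ 0 < R₀ ∧ 0 < θ₀ ∧ ∀ (mv kk r : ℕ), 1 ≤ kk → 1 ≤ r → w₀ ≤ ((L ^ mv : ℕ) : ℝ) → ∀ {mm : Type} [Fintype mm] [DecidableEq mm] (e : Matrix mm mm ℂ ≃L[ℝ] (ι → ℝ)), (∀ A B : Matrix mm mm ℂ, traceForm A B = e A ⬝ᵥ e B) → ∀ (u' : (Fin (d + 1) → ZMod (2 * L)) → ScX' d L mv kk r hL → Matrix mm mm ℂ), (∀ k x', (u' k x')ᴴ * u' k x' = 1) → ∀ (U : Fin (d + 1) → ScX d L mv kk hL → Matrix mm mm ℂ) (U' : Fin (d + 1) → ScX' d L mv kk r hL → Matrix mm mm ℂ), (∀ μ x', (U' μ x')ᴴ * U' μ x' = 1) → ∀ (P : (ScX d L mv kk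 hL × ι → ℝ) →ₗ[ℝ] (ScX d L mv kk hL × ι → ℝ)) (P' : (ScX' d L mv kk r hL × ι → ℝ) →ₗ[ℝ] (ScX' d L mv kk r hL × ι → ℝ)) (NV : (Fin (d + 1) → ZMod (2 * L)) → (ScX d L mv kk hL × ι → ℝ) →ₗ[ℝ] (ScX d L mv kk hL × ι → ℝ)) (NV' : (Fin (d + 1) → ZMod (2 * L)) → (ScX' d L mv kk r hL × ι → ℝ) →ₗ[ℝ] (ScX' d L mv kk r hL × ι → ℝ)) (rV RN θF rD oV oN o ρ : ℝ), 0 ≤ rV → 0 ≤ RN → 0 ≤ rD → 0 ≤ oV → 0 ≤ oN → 0 ≤ ρ → rV * (1 + Fintype.card (Fin (d + 1) ⊕ Fin (d + 1))) + RN ≤ R₀ → oV * (1 + Fintype.card (Fin (d + 1) ⊕ Fin (d + 1))) + oN ≤ o → θF ≤ θ₀ →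
        (∀ k, mmulOp (fun x => coordMat e (ContinuousLinearMap.mulLeftRight ℝ (Matrix mm mm ℂ) (u' k (kingSec (cvM d L mv kk hL) L kk r x)) (u' k (kingSec (cvM d L mv kk hL) L kk r x))ᴴ)) ∘ₗ P ∘ₗ mmulOp (fun x => (coordMat e (ContinuousLinearMap.mulLeftRight ℝ (Matrix mm mm ℂ) (u' k (kingSec (cvM d L mv kk hL) L kk r x)) (u' k (kingSec (cvM d L mv kk hL) L kk r x))ᴴ))ᵀ) = (scQQ d L mv kk hL (aK a₀ (L : ℝ) kk * (((L ^ kk : ℕ) : ℝ)) ^ (d + 1)) ι) - NV k) → (∀ k, mmulOp (fun x' => coordMat e (ContinuousLinearMap.mulLeftRight ℝ (Matrix mm mm ℂ) (u' k x') (u' k x')ᴴ)) ∘ₗ P' ∘ₗ mmulOp (fun x' => (coordMat e (ContinuousLinearMap.mulLeftRight ℝ (Matrix mm mm ℂ) (u' k x') (u' k x')ᴴ))ᵀ) = (scQQ' d L mv kk r hL (aK a₀ (L : ℝ) (r + kk) * (((L ^ r * L ^ kk : ℕ) : ℝ)) ^ (d + 1)) ι) - NV' k) → (∀ k x, scChi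 d L mv kk hL k x ≠ 0 → ∀ i, ∑ j, |tCoefC ((((L ^ kk : ℕ) : ℝ))⁻¹) (gaugePair (scShift d L mv kk hL) fun μ x => coordMat e (ContinuousLinearMap.mulLeftRight ℝ (Matrix mm mm ℂ) (u' k (kingSec (cvM d L mv kk hL) L kk r x) * U μ x * (u' k (kingSec (cvM d L mv kk hL) L kk r (scShift d L mv kk hL μ x)))ᴴ) (u' k (kingSec (cvM d L mv kk hL) L kk r x) * U μ x * (u' k (kingSec (cvM d L mv kk hL) L kk r (scShift d L mv kk hL μ x)))ᴴ)ᴴ)) x i j| ≤ rV) →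
        (∀ k j' x, scChi d L mv kk hL k x ≠ 0 → ∀ i, ∑ j, |tCoefA ((((L ^ kk : ℕ) : ℝ))⁻¹) (gaugePair (scShift d L mv kk hL) fun μ x => coordMat e (ContinuousLinearMap.mulLeftRight ℝ (Matrix mm mm ℂ) (u' k (kingSec (cvM d L mv kk hL) L kk r x) * U μ x * (u' k (kingSec (cvM d L mv kk hL) L kk r (scShift d L mv kk hL μ x)))ᴴ) (u' k (kingSec (cvM d L mv kk hL) L kk r x) * U μ x * (u' k (kingSec (cvM d L mv kk hL) L kk r (scShift d L mv kk hL μ x)))ᴴ)ᴴ)) j' x i j| ≤ rV) → (∀ k x', scChi' d L mv kk r hL k x' ≠ 0 → ∀ i, ∑ j, |tCoefC ((((L ^ r * L ^ kk : ℕ) : ℝ))⁻¹) (gaugePair (scShift' d L mv kk r hL) fun μ x' => coordMat e (ContinuousLinearMap.mulLeftRight ℝ (Matrix mm mm ℂ) (u' k x' * U' μ x' * (u' k (scShift' d L mv kk r hL μ x'))ᴴ) (u' k x' * U' μ x' * (u' k (scShift' d L mv kk r hL μ x'))ᴴ)ᴴ)) x' i j| ≤ rV) → (∀ k j' x', scChi'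 d L mv kk r hL k x' ≠ 0 → ∀ i, ∑ j, |tCoefA ((((L ^ r * L ^ kk : ℕ) : ℝ))⁻¹) (gaugePair (scShift' d L mv kk r hL) fun μ x' => coordMat e (ContinuousLinearMap.mulLeftRight ℝ (Matrix mm mm ℂ) (u' k x' * U' μ x' * (u' k (scShift' d L mv kk r hL μ x'))ᴴ) (u' k x' * U' μ x' * (u' k (scShift' d L mv kk r hL μ x'))ᴴ)ᴴ)) j' x' i j| ≤ rV) →
        (∀ k x' i, ∑ j, |(scChi' d L mv kk r hL k x' • tCoefC ((((L ^ r * L ^ kk : ℕ) : ℝ))⁻¹) (gaugePair (scShift' d L mv kk r hL) fun μ x' => coordMat e (ContinuousLinearMap.mulLeftRight ℝ (Matrix mm mm ℂ) (u' k x' * U' μ x' * (u' k (scShift' d L mv kk r hL μ x'))ᴴ) (u' k x' * U' μ x' * (u' k (scShift' d L mv kk r hL μ x'))ᴴ)ᴴ)) x') i j - (scChi d L mv kk hL k ((kingPr L kk r (cvM d L mv kk hL)) x') • tCoefC ((((L ^ kk : ℕ) : ℝ))⁻¹) (gaugePair (scShift d L mv kk hL) fun μ x => coordMat e (ContinuousLinearMap.mulLeftRight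 ℝ (Matrix mm mm ℂ) (u' k (kingSec (cvM d L mv kk hL) L kk r x) * U μ x * (u' k (kingSec (cvM d L mv kk hL) L kk r (scShift d L mv kk hL μ x)))ᴴ) (u' k (kingSec (cvM d L mv kk hL) L kk r x) * U μ x * (u' k (kingSec (cvM d L mv kk hL) L kk r (scShift d L mv kk hL μ x)))ᴴ)ᴴ)) ((kingPr L kk r (cvM d L mv kk hL)) x')) i j| ≤ oV) →
        (∀ k j' x' i, ∑ j, |(scChi' d L mv kk r hL k x' • tCoefA ((((L ^ r * L ^ kk : ℕ) : ℝ))⁻¹) (gaugePair (scShift' d L mv kk r hL) fun μ x' => coordMat e (ContinuousLinearMap.mulLeftRight ℝ (Matrix mm mm ℂ) (u' k x' * U' μ x' * (u' k (scShift' d L mv kk r hL μ x'))ᴴ) (u' k x' * U' μ x' * (u' k (scShift' d L mv kk r hL μ x'))ᴴ)ᴴ)) j' x') i j - (scChi d L mv kk hL k ((kingPr L kk r (cvM d L mv kk hL)) x') • tCoefA ((((L ^ kk : ℕ) : ℝ))⁻¹) (gaugePair (scShift d L mv kk hL) fun μ x => coordMat e (ContinuousLinearMap.mulLeftRight ℝ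 (Matrix mm mm ℂ) (u' k (kingSec (cvM d L mv kk hL) L kk r x) * U μ x * (u' k (kingSec (cvM d L mv kk hL) L kk r (scShift d L mv kk hL μ x)))ᴴ) (u' k (kingSec (cvM d L mv kk hL) L kk r x) * U μ x * (u' k (kingSec (cvM d L mv kk hL) L kk r (scShift d L mv kk hL μ x)))ᴴ)ᴴ)) j' ((kingPr L kk r (cvM d L mv kk hL)) x')) i j| ≤ oV) → (∀ k, HasMaj (ScNorm d L mv kk hL ι) (ScNorm d L mv kk hL ι) (mulOp (fun p : ScX d L mv kk hL × ι => scPsi d L mv kk hL k p.1) ∘ₗ NV k ∘ₗ mulOp (fun p : ScX d L mv kk hL × ι => scChi d L mv kk hL k p.1)) (fun y y' => RN * Real.exp (-(δ * (unitTorusGeo L kk (cvM d L mv kk hL)).dist y y')))) →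
        (∀ k, HasMaj (ScNorm' d L mv kk r hL ι) (ScNorm' d L mv kk r hL ι) (mulOp (fun p : ScX' d L mv kk r hL × ι => scPsi' d L mv kk r hL k p.1) ∘ₗ NV' k ∘ₗ mulOp (fun p : ScX' d L mv kk r hL × ι => scChi' d L mv kk r hL k p.1)) (fun y y' => RN * Real.exp (-(δ * (unitTorusGeo L kk (cvM d L mv kk hL)).dist y y')))) → (∀ k, HasMaj (ScNorm d L mv kk hL ι) (BlockNorm.ofBlocks (unitTorusGeo L kk (cvM d L mv kk hL)) (liftBlk (scBlk d L mv kk hL ∘ kingPr L kk r (cvM d L mv kk hL)) ι)) (idef (pull (liftMap (kingPr L kk r (cvM d L mv kk hL)) ι)) (pull (liftMap (kingPr L kk r (cvM d L mv kk hL)) ι)) (mulOp (fun p : ScX' d L mv kk r hL × ι => scPsi' d L mv kk r hL k p.1) ∘ₗ NV' k ∘ₗ mulOp (fun p : ScX' d L mv kk r hL × ι => scChi' d L mv kk r hL k p.1)) (mulOp (fun p : ScX d L mv kk hL × ι => scPsi d L mv kk hL k p.1) ∘ₗ NV k ∘ₗ mulOp (fun p : ScX d L mv kk hL × ι => scChi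 d L mv kk hL k p.1))) (fun y y' => oN * Real.exp (-(δ * (unitTorusGeo L kk (cvM d L mv kk hL)).dist y y')))) → (∀ k, HasMaj (ScNorm d L mv kk hL ι) (ScNorm d L mv kk hL ι) ((LinearMap.id - mulOp (fun p : ScX d L mv kk hL × ι => scPsi d L mv kk hL k p.1)) ∘ₗ NV k ∘ₗ mulOp (fun p : ScX d L mv kk hL × ι => scChi d L mv kk hL k p.1)) (fun y y' => θF * Real.exp (-(δ * (unitTorusGeo L kk (cvM d L mv kk hL)).dist y y')))) →
        (∀ k, HasMaj (ScNorm' d L mv kk r hL ι) (ScNorm' d L mv kk r hL ι) ((LinearMap.id - mulOp (fun p : ScX' d L mv kk r hL × ι => scPsi' d L mv kk r hL k p.1)) ∘ₗ NV' k ∘ₗ mulOp (fun p : ScX' d L mv kk r hL × ι => scChi' d L mv kk r hL k p.1)) (fun y y' => θF * Real.exp (-(δ * (unitTorusGeo L kk (cvM d L mv kk hL)).dist y y')))) → (∀ k, HasMaj (ScNorm d L mv kk hL ι) (BlockNorm.ofBlocks (unitTorusGeo L kk (cvM d L mv kk hL)) (liftBlk (scBlk d L mv kk hL ∘ kingPr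 L kk r (cvM d L mv kk hL)) ι)) (idef (pull (liftMap (kingPr L kk r (cvM d L mv kk hL)) ι)) (pull (liftMap (kingPr L kk r (cvM d L mv kk hL)) ι)) ((LinearMap.id - mulOp (fun p : ScX' d L mv kk r hL × ι => scPsi' d L mv kk r hL k p.1)) ∘ₗ NV' k ∘ₗ mulOp (fun p : ScX' d L mv kk r hL × ι => scChi' d L mv kk r hL k p.1)) ((LinearMap.id - mulOp (fun p : ScX d L mv kk hL × ι => scPsi d L mv kk hL k p.1)) ∘ₗ NV k ∘ₗ mulOp (fun p : ScX d L mv kk hL × ι => scChi d L mv kk hL k p.1))) (fun y y' => rD * Real.exp (-(δ * (unitTorusGeo L kk (cvM d L mv kk hL)).dist y y')))) →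
        -- the (3.35) COLUMN letter of `Ad(u′_kU′u′_kᴴ)` on the plateau cube of `k`, and the locality row of `P`
        (∀ k μ y', scBlk' d L mv kk r hL y' ∈ cvSk d L mv kk hL k → ∀ j, ∑ i, |(coordMat e (ContinuousLinearMap.mulLeftRight ℝ (Matrix mm mm ℂ) (u' k y' * U' μ y' * (u' k (y' + unitVec (fine (L ^ r * L ^ kk) (cvM d L mv kk hL)) μ))ᴴ) (u' k y' * U' μ y' * (u' k (y' + unitVec (fine (L ^ r * L ^ kk) (cvM d L mv kk hL)) μ))ᴴ)ᴴ) - 1) i j| ≤ ρ) → (∀ k, mulOp (fun p : ScX d L mv kk hL × ι => 1 - scPsi d L mv kk hL k p.1) ∘ₗ P ∘ₗ mulOp (fun p : ScX d L mv kk hL × ι => scH d L mv kk hL k p.1) = 0) → HasMaj (ScNorm d L mv kk hL ι) (BlockNorm.ofBlocks (unitTorusGeo L kk (cvM d L mv kk hL)) (liftBlk (scBlk d L mv kk hL ∘ kingPr L kk r (cvM d L mv kk hL)) ι)) (idef (ctauS (cvM d L mv kk hL) L kk r (fun μ x' => coordMat e (ContinuousLinearMap.mulLeftRight ℝ (Matrix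 mm mm ℂ) (U' μ x') (U' μ x')ᴴ))) (ctauS (cvM d L mv kk hL) L kk r (fun μ x' => coordMat e (ContinuousLinearMap.mulLeftRight ℝ (Matrix mm mm ℂ) (U' μ x') (U' μ x')ᴴ))) (scGlued' d L mv kk r hL (aK a₀ (L : ℝ) (r + kk) * (((L ^ r * L ^ kk : ℕ) : ℝ)) ^ (d + 1)) ((((L ^ r * L ^ kk : ℕ) : ℝ))⁻¹) ι e u' U' P' NV') (scGlued d L mv kk hL (aK a₀ (L : ℝ) kk * (((L ^ kk : ℕ) : ℝ)) ^ (d + 1)) ((((L ^ kk : ℕ) : ℝ))⁻¹) ι e (fun k x => u' k (kingSec (cvM d L mv kk hL) L kk r x)) U P NV))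
          (fun y y' => D * (((L : ℝ) ^ kk) ^ (-(1 / 4 : ℝ)) + (o + (((1 + ρ) ^ ((d + 1) * (L ^ r - 1)) - 1) + rD))) * Real.exp (-(δ / 16 * (unitTorusGeo L kk (cvM d L mv kk hL)).dist y y'))) := by
  have hL2 : 2 ≤ L := (by omega); have hL3 : 3 ≤ L := (by omega); have hL4 : 4 ≤ L := (by omega); have hLpos : 0 < L := (by omega); have hL1r : (1 : ℝ) < (L : ℝ) := (by exact_mod_cast hL.2); have hL2R : (2 : ℝ) ≤ (L : ℝ) := (by exact_mod_cast hL2)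
  obtain ⟨C, δm, hC, hδm0, H⟩ := flatRowsAll_king (d := d) L hL.1 hL2 ha₀ (γ := (1 / 4 : ℝ)) (by norm_num) (by norm_num)
  let cr : ℝ := B4Sect5Proof.latticeConst (d + 1) (δm / 32); have hcr_def : cr = B4Sect5Proof.latticeConst (d + 1) (δm / 32) := rfl; have hcr0 : 0 ≤ cr := B4Sect5Proof.latticeConst_nonneg (d + 1) (by positivity); let β : ℝ := C; let β₁ : ℝ := C; let Nov : ℝ := (((2 * L) ^ (d + 1) : ℕ) : ℝ); let cι2 : ℝ := (Fintype.card ι : ℝ) ^ 2; let E' : ℝ := (Real.exp 1 * (δm / 2))⁻¹; let R : ℝ := 1 / (2 * ((β + (β₁ + π * β)) * cr * cr) + 1); have hRdef : R = 1 / (2 * ((β + (β₁ + π * β)) * cr * cr) + 1) := rfl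
  let θ₀ : ℝ := 1 / (4 * (Nov * cr * (cι2 * (2 * (β + (β₁ + π * β))) * cr)) + 4); have hθ₀def : θ₀ = 1 / (4 * (Nov * cr * (cι2 * (2 * (β + (β₁ + π * β))) * cr)) + 4) := rfl
  let A₁ : ℝ := (Fintype.card (Fin (d + 1)) : ℝ) * (32 * π ^ 2 * (2 * (β + (β₁ + π * β))) + 2 * (π * (2 * (β + (β₁ + π * β))))) +
    (π * ((d : ℝ) + 1) * 0 + 2 * (π * ((d : ℝ) + 1))) * a₀ * (2 * (β + (β₁ + π * β))) * cr
  let A₂ : ℝ := (π * ((d : ℝ) + 1) * (Real.exp 1 * (δm / 2))⁻¹ + 2 * (π * ((d : ℝ) + 1) + π * ((d : ℝ) + 1) * 1)) * R * (2 * (β + (β₁ + π * β))) * cr +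
    R * π * (2 * (β + (β₁ + π * β))) * cr
  let w₀ : ℝ := 4 * (Nov * cr * (cι2 * (A₁ + A₂ + 2 * 0))) + 2; let KRN : ℝ := (π * (d + 1) * E' + 2 * (π * (d + 1))) * (4 / 3 * a₀) + 2 * (π * (d + 1)) * (2 * a₀); have hβ0 : 0 ≤ β := hC.le; have hβ₁0 : 0 ≤ β₁ := hC.le; have hNov0 : 0 ≤ Nov := (by positivity); have hcι20 : 0 ≤ cι2 := (by positivity); have hE'0 : 0 ≤ E' := (by positivity); have hR0 : 0 < R := (by positivity); have hθ₀0 : 0 < θ₀ := (by positivity); have hA₁0 : 0 ≤ A₁ := (by positivity); have hA₂0 : 0 ≤ A₂ := (by positivity); have hKRN0 : 0 ≤ KRN := (by positivity)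
  let D335 : ℝ := ((((Nov * (cι2 * ((β + (β₁ + (π * β))) * 2))) * ((2 * ((2 * (Nov * ((((cι2 * ((((((Fintype.card (Fin (d + 1)) : ℝ) * (((32 * π ^ 2) * ((β + (β₁ + (π * β))) * 2)) + (2 * (π * ((β + (β₁ + (π * β))) * 2))))) + (0:ℝ)) + ((((π * (d + 1) * 0 + 2 * (π * (d + 1))) * a₀) * ((β + (β₁ + (π * β))) * 2)) * cr)) + (((((π * (d + 1) * E' + 2 * (π * (d + 1) + π * (d + 1) * 1)) * R) * ((β + (β₁ + (π * β))) * 2)) * cr) + (((R * π) * ((β + (β₁ + (π * β))) * 2)) * cr))) + ((θ₀ * (1 * ((β + (β₁ + (π * β))) * 2))) * cr))) * ((Fintype.card ι : ℝ) * (π * (d + 1)))) + (cι2 * ((((((((Fintype.card (Fin (d + 1)) : ℝ) * ((((32 * π ^ 2) * ((((((C + ((π * (d + 1)) * β)) + (((C + ((2 * (π * (d + 1))) * β₁)) + (π * C)) + ((32 * π ^ 4 + π ^ 2 * (d + 1)) * β))) * cr) + ((1 * (((C + ((π * (d + 1)) * β)) + (((C + ((2 * (π * (d + 1))) * β₁))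 + (π * C)) + ((32 * π ^ 4 + π ^ 2 * (d + 1)) * β))) * cr)) * ((R * ((β + (β₁ + (π *
    β))) * 2)) * cr))) + (((((β + (β₁ + (π * β))) * (1:ℝ)) * cr) * ((β + (β₁ + (π * β))) * 2)) * cr)) * 2)) + ((144 * π ^ 3 + 32 * π ^ 3 * Fintype.card (Fin (d + 1))) * ((β + (β₁ + (π * β))) * 2))) + (2 * ((π * ((((((C + ((π * (d + 1)) * β)) + (((C + ((2 * (π * (d + 1))) * β₁)) + (π * C)) + ((32 * π ^ 4 + π ^ 2 * (d + 1)) * β))) * cr) + ((1 * (((C + ((π * (d + 1)) * β)) + (((C + ((2 * (π * (d + 1))) * β₁)) + (π * C)) + ((32 * π ^ 4 + π ^ 2 * (d + 1)) * β))) * cr)) * ((R * ((β + (β₁ + (π * β))) * 2)) * cr))) + (((((β + (β₁ + (π * β))) * (1:ℝ)) * cr) * ((β + (β₁ + (π * β))) * 2)) * cr)) * 2)) + ((64 * π ^ 2 + π ^ 2 * Fintype.card (Fin (d + 1))) * ((β + (β₁ + (π * β))) * 2)))))) + (0:ℝ)) + (((((π * (d + 1) * 0 + 2 * (π * (d + 1)))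 * a₀) * ((((((C + ((π * (d + 1)) * β)) + (((C + ((2 * (π * (d + 1))) * β₁)) + (π * C)) + ((32 * π ^ 4 + π ^ 2 * (d + 1)) * β))) * cr) + ((1 * (((C + ((π * (d +
    1)) * β)) + (((C + ((2 * (π * (d + 1))) * β₁)) + (π * C)) + ((32 * π ^ 4 + π ^ 2 * (d + 1)) * β))) * cr)) * ((R * ((β + (β₁ + (π * β))) * 2)) * cr))) + (((((β + (β₁ + (π * β))) * (1:ℝ)) * cr) * ((β + (β₁ + (π * β))) * 2)) * cr)) * 2)) * cr) + ((KRN * ((β + (β₁ + (π * β))) * 2)) * cr))) + (((((((π * (d + 1) * E' + 2 * (π * (d + 1) + π * (d + 1) * 1)) * R) * ((((((C + ((π * (d + 1)) * β)) + (((C + ((2 * (π * (d + 1))) * β₁)) + (π * C)) + ((32 * π ^ 4 + π ^ 2 * (d + 1)) * β))) * cr) + ((1 * (((C + ((π * (d + 1)) * β)) + (((C + ((2 * (π * (d + 1))) * β₁)) + (π * C)) + ((32 * π ^ 4 + π ^ 2 * (d + 1)) * β))) * cr)) * ((R * ((β + (β₁ + (π * β))) * 2)) * cr))) + (((((β + (β₁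 + (π * β))) * (1:ℝ)) * cr) * ((β + (β₁ + (π * β))) * 2)) * cr)) * 2)) + ((((π * (d + 1) * E' + 2 * (π * (d + 1) + π * (d + 1) * 1)) * (1:ℝ)) + ((2 * R) * (((π * (d + 1)) + π) + π))) * ((β + (β₁ + (π * β))) * 2))) + (R *
    ((π * ((((((C + ((π * (d + 1)) * β)) + (((C + ((2 * (π * (d + 1))) * β₁)) + (π * C)) + ((32 * π ^ 4 + π ^ 2 * (d + 1)) * β))) * cr) + ((1 * (((C + ((π * (d + 1)) * β)) + (((C + ((2 * (π * (d + 1))) * β₁)) + (π * C)) + ((32 * π ^ 4 + π ^ 2 * (d + 1)) * β))) * cr)) * ((R * ((β + (β₁ + (π * β))) * 2)) * cr))) + (((((β + (β₁ + (π * β))) * (1:ℝ)) * cr) * ((β + (β₁ + (π * β))) * 2)) * cr)) * 2)) + ((64 * π ^ 2 + π ^ 2 * Fintype.card (Fin (d + 1))) * ((β + (β₁ + (π * β))) * 2))))) + (((1:ℝ) * π) * ((β + (β₁ + (π * β))) * 2))) * cr)) + (((θ₀ * ((1 * ((((((C + ((π * (d + 1)) * β)) + (((C + ((2 * (π * (d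 + 1))) * β₁)) + (π * C)) + ((32 * π ^ 4 + π ^ 2 * (d + 1)) * β))) * cr) + ((1 * (((C + ((π * (d + 1)) * β)) + (((C + ((2 * (π * (d + 1))) * β₁)) + (π * C)) + ((32 * π ^ 4 + π ^ 2 * (d + 1)) * β))) * cr)) * ((R * ((β + (β₁ + (π * β))) * 2)) * cr))) + (((((β + (β₁ + (π * β))) * (1:ℝ)) * cr) *
    ((β + (β₁ + (π * β))) * 2)) * cr)) * 2)) + ((1 * ((β + (β₁ + (π * β))) * 2)) * (π * (d + 1))))) * cr) + (((1:ℝ) * (1 * ((β + (β₁ + (π * β))) * 2))) * cr))) + ((1:ℝ) * ((((((Fintype.card (Fin (d + 1)) : ℝ) * (((32 * π ^ 2) * ((β + (β₁ + (π * β))) * 2)) + (2 * (π * ((β + (β₁ + (π * β))) * 2))))) + (0:ℝ)) + ((((π * (d + 1) * 0 + 2 * (π * (d + 1))) * a₀) * ((β + (β₁ + (π * β))) * 2)) * cr)) + (((((π * (d + 1) * E' + 2 * (π * (d + 1) + π * (d + 1) * 1)) * R) * ((β + (β₁ + (π * β))) * 2)) * cr) + (((R * π) * ((β + (β₁ + (π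 * β))) * 2)) * cr))) + ((θ₀ * (1 * ((β + (β₁ + (π * β))) * 2))) * cr)))) + ((1:ℝ) * ((((((Fintype.card (Fin (d + 1)) : ℝ) * (((32 * π ^ 2) * ((β + (β₁ + (π * β))) * 2)) + (2 * (π * ((β + (β₁ + (π * β))) * 2))))) + (0:ℝ)) + ((((π * (d + 1) * 0 + 2 * (π * (d + 1))) * a₀) * ((β + (β₁ + (π * β))) * 2)) * cr)) + (((((π * (d + 1) * E' + 2 * (π * (d + 1) + π * (d + 1) * 1)) *
    R) * ((β + (β₁ + (π * β))) * 2)) * cr) + (((R * π) * ((β + (β₁ + (π * β))) * 2)) * cr))) + ((θ₀ * (1 * ((β + (β₁ + (π * β))) * 2))) * cr)))))) + (((cι2 * (((0:ℝ) * 2) + 0)) * ((Fintype.card ι : ℝ) * (π * (d + 1)))) + (cι2 * (((((((0:ℝ) * ((R * ((((((C + ((π * (d + 1)) * β)) + (((C + ((2 * (π * (d + 1))) * β₁)) + (π * C)) + ((32 * π ^ 4 + π ^ 2 * (d + 1)) * β))) * cr) + ((1 * (((C + ((π * (d + 1)) * β)) + (((C + ((2 * (π * (d + 1))) * β₁)) +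 (π * C)) + ((32 * π ^ 4 + π ^ 2 * (d + 1)) * β))) * cr)) * ((R * ((β + (β₁ + (π * β))) * 2)) * cr))) + (((((β + (β₁ + (π * β))) * (1:ℝ)) * cr) * ((β + (β₁ + (π * β))) * 2)) * cr)) * 2)) + ((1:ℝ) * ((β + (β₁ + (π * β))) * 2)))) * cr) * cr) + ((0:ℝ) * (1 + (((R * ((β + (β₁ + (π * β))) * 2)) * cr) * cr)))) + ((1:ℝ) * (((0:ℝ) * 2) + 0))) + ((1:ℝ) * (((0:ℝ) * 2) + 0)))))))) * cr)) * cr)) * cr) + (((Nov * (((2 * (cι2 * ((β + (β₁ + (π * β))) * 2))) *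
    ((Fintype.card ι : ℝ) * (π * (d + 1)))) + (cι2 * ((((((((C + ((π * (d + 1)) * β)) + (((C + ((2 * (π * (d + 1))) * β₁)) + (π * C)) + ((32 * π ^ 4 + π ^ 2 * (d + 1)) * β))) * cr) + ((1 * (((C + ((π * (d + 1)) * β)) + (((C + ((2 * (π * (d + 1))) * β₁)) + (π * C)) + ((32 * π ^ 4 + π ^ 2 * (d + 1)) * β))) * cr)) * ((R * ((β + (β₁ + (π * β))) * 2)) * cr))) + (((((β + (β₁ + (π * β))) * (1:ℝ)) * cr) * ((β + (β₁ + (π * β))) * 2)) * cr)) * 2) + ((1:ℝ) * ((β + (β₁ + (π * β))) * 2))) + ((1:ℝ) * ((β + (β₁ + (π * β))) * 2)))))) * 2) * cr))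
  refine ⟨δm, w₀, R, θ₀, D335, hδm0, hR0, hθ₀0, fun mv kk r hk hr hw₀ => ?_⟩
  intro mm _ _ e he u' hu' U U' hU' P P' NV NV' rV RN θF rD oV oN o ρ hrV hRN hrD hoV hoN hρ0 hRle hole hθle
    hP hP' hCloc hAloc hCloc' hAloc' hfitC hfitA hNVcut hNVcut' hDNV hfarN hfarN' hDfarN hρ hPloc
  -- the data of the cover at `(m, k, r)`
  have hn : 1 ≤ L ^ kk := Nat.one_le_pow _ _ hLpos; have hn' : 1 ≤ L ^ r * L ^ kk := Nat.mul_pos (Nat.one_le_pow _ _ hLpos) (Nat.one_le_pow _ _ hLpos); have hW0 : 4 * (Nov * cr * (cι2 * (A₁ + A₂ + 2 * 0))) ≤ ((L ^ mv : ℕ) : ℝ) := (by linarith only [hw₀])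
  have hW2R : (2 : ℝ) ≤ ((L ^ mv : ℕ) : ℝ) := by
    have : 0 ≤ 4 * (Nov * cr * (cι2 * (A₁ + A₂ + 2 * 0))) := by positivity
    linarith only [this, hw₀]
  have hW2 : 2 ≤ L ^ mv := (by exact_mod_cast hW2R); have hw : 0 < L ^ mv := (by omega); have hW1 : (1 : ℝ) ≤ ((L ^ mv : ℕ) : ℝ) := (by linarith only [hW2R]); have hWpos : (0 : ℝ) < ((L ^ mv : ℕ) : ℝ) := (by linarith only [hW2R])
  have hW3 : 3 ≤ L ^ mv := by
    have hmv : mv ≠ 0 := by rintro rfl; simp at hW2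
    calc 3 ≤ L := hL3
      _ = L ^ 1 := (pow_one L).symm
      _ ≤ L ^ mv := Nat.pow_le_pow_right hLpos (Nat.one_le_iff_ne_zero.mpr hmv)
  have hM : ∀ ν, cvM d L mv kk hL ν = 2 * L * L ^ mv := MP_succ_eq L mv kk hL; have hMc : ∀ ν, cvM d L mv kk hL ν = 2 * L ^ (mv + 1) := fun ν => rfl; have hlo : (2 : ℝ) * ((L ^ mv : ℕ) : ℝ) ≤ ((2 * L ^ mv : ℕ) : ℝ) := (by push_cast; exact le_rfl); have hhi : ((2 * L ^ mv : ℕ) : ℝ) + ((L ^ mv : ℕ) : ℝ) + (2 + 1) * ((L ^ mv : ℕ) : ℝ) + 1 ≤ ((6 * L ^ mv + 1 : ℕ) : ℝ) := (by push_cast; linarith only [])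
  have hS6 : 6 * L ^ mv + 1 ≤ 2 * L * L ^ mv := by
    have h7 : 7 * L ^ mv ≤ L * L ^ mv := Nat.mul_le_mul_right _ hL7
    have e7 : 2 * L * L ^ mv = 2 * (L * L ^ mv) := by ring
    rw [e7]; omega
  have hm₁ : 2 * L ^ mv ≤ coverMargin L mv := two_mul_le_coverMargin hL7 mv; have hfitI : coverMargin L mv - 2 * L ^ mv + (6 * L ^ mv + 1) ≤ L * L ^ mv := coverMargin_inner_fit hL7 hW2; have hfit0 := coverMargin_fit hL3 mv; have hfit : coverMargin L mv + 2 * L ^ mv + 1 ≤ L * L ^ mv := (by omega); have hS0 : L * L ^ mv ≤ 2 * L * L ^ mv := (by rw [mul_assoc]; omega); have hmg₂ : 2 * L ^ mv + 1 ≤ coverMargin L mv := (coverMargin_cut_margin hL7 hW3).1; have hfg₂ : coverMargin L mv - 2 * L ^ mv + (6 * L ^ mv + 1) + 1 ≤ L * L ^ mv := (coverMargin_cut_margin hL7 hW3).2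
  have h3 : 3 ≤ L ^ kk * L ^ mv :=
    calc 3 ≤ L ^ mv := hW3
      _ = 1 * L ^ mv := (one_mul _).symm
      _ ≤ L ^ kk * L ^ mv := Nat.mul_le_mul_right _ hn
  have hK0 : 0 < 2 * L := (by omega); have hK2 : 2 ≤ 2 * L := (by omega); have hLr : 0 < L ^ r := pow_pos hLpos r; let η : ℝ := (((L ^ kk : ℕ) : ℝ))⁻¹; let η' : ℝ := (((L ^ r * L ^ kk : ℕ) : ℝ))⁻¹; let W : ℝ := ((L ^ mv : ℕ) : ℝ); have hWdef : W = ((L ^ mv : ℕ) : ℝ) := rfl; have hηinv : η⁻¹ = ((L ^ kk : ℕ) : ℝ) := inv_inv _; have hη'inv : η'⁻¹ = ((L ^ r * L ^ kk : ℕ) : ℝ) := inv_inv _; have hnr : (0 : ℝ) < ((L ^ kk : ℕ) : ℝ) := (by exact_mod_cast hn); have hnr' : (0 : ℝ) < ((L ^ r * L ^ kk : ℕ) : ℝ) := (by exact_mod_cast hn')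
  have hη0 : 0 ≤ η := inv_nonneg.mpr hnr.le; have hη'0 : 0 ≤ η' := inv_nonneg.mpr hnr'.le; have hnR : (1 : ℝ) ≤ ((L ^ kk : ℕ) : ℝ) := (by exact_mod_cast hn); have hnn' : ((L ^ kk : ℕ) : ℝ) ≤ ((L ^ r * L ^ kk : ℕ) : ℝ) := (by exact_mod_cast Nat.le_mul_of_pos_left _ hLr)
  -- the site coordinates' steps and the partition letters, both grids (n15-c∕262∕263)
  have hξS := scXi_shift_lift ι hM hw (d := d) (L := L) (mv := mv) (kk := kk) (hL := hL); have hξS' := scXi'_shift_lift ι hM hw (d := d) (L := L) (mv := mv) (kk := kk) (r := r) (hL := hL); have hs0c : (0 : ℝ) ≤ ((((L ^ kk : ℕ) : ℝ)) * ((L ^ mv : ℕ) : ℝ))⁻¹ := (by positivity); have hs1c : ((((L ^ kk : ℕ) : ℝ)) * ((L ^ mv : ℕ) : ℝ))⁻¹ ≤ 1 := inv_le_one_of_one_le₀ (one_le_mul_of_one_le_of_one_le (by exact_mod_cast hn) hW1)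
  have hs0f : (0 : ℝ) ≤ ((((L ^ r * L ^ kk : ℕ) : ℝ)) * ((L ^ mv : ℕ) : ℝ))⁻¹ := (by positivity); have hs1f : ((((L ^ r * L ^ kk : ℕ) : ℝ)) * ((L ^ mv : ℕ) : ℝ))⁻¹ ≤ 1 := inv_le_one_of_one_le₀ (one_le_mul_of_one_le_of_one_le (by exact_mod_cast hn') hW1)
  have hsW : |((L ^ kk : ℕ) : ℝ)| * (π * |((((L ^ kk : ℕ) : ℝ)) * ((L ^ mv : ℕ) : ℝ))⁻¹|) = π / W := by
    rw [abs_of_pos hnr, abs_of_nonneg hs0c, mul_inv, hWdef]; field_simp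
  have hsW2 : ((L ^ kk : ℕ) : ℝ) ^ 2 * (32 * π ^ 2 * (((((L ^ kk : ℕ) : ℝ)) * ((L ^ mv : ℕ) : ℝ))⁻¹) ^ 2) = 32 * π ^ 2 / W ^ 2 := by
    rw [mul_inv, hWdef]; field_simp
  have hsW' : |((L ^ r * L ^ kk : ℕ) : ℝ)| * (π * |((((L ^ r * L ^ kk : ℕ) : ℝ)) * ((L ^ mv : ℕ) : ℝ))⁻¹|) = π / W := by
    rw [abs_of_pos hnr', abs_of_nonneg hs0f, mul_inv, hWdef]; field_simp
  have hsW2' : ((L ^ r * L ^ kk : ℕ) : ℝ) ^ 2 * (32 * π ^ 2 * (((((L ^ r * L ^ kk : ℕ) : ℝ)) * ((L ^ mv : ℕ) : ℝ))⁻¹) ^ 2) = 32 * π ^ 2 / W ^ 2 := by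
    rw [mul_inv, hWdef]; field_simp
  -- King's window and the flat rows at the masses `a_K(a₀, L, k)·n^{d+1}`, `a_K(a₀, L, r+k)·n′^{d+1}` (Ξ-4 rows 1–12)
  have haK : 0 < aK a₀ (L : ℝ) kk := aK_pos ha₀ hL1r hk; have haKle : aK a₀ (L : ℝ) kk ≤ a₀ := aK_le ha₀ hL1r hk; have ha' : 0 < aK a₀ (L : ℝ) kk * (((L ^ kk : ℕ) : ℝ)) ^ (d + 1) := (by positivity); have haK' : 0 < aK a₀ (L : ℝ) (r + kk) := aK_pos ha₀ hL1r (hk.trans (Nat.le_add_left kk r)); have haKle' : aK a₀ (L : ℝ) (r + kk) ≤ a₀ := aK_le ha₀ hL1r (hk.trans (Nat.le_add_left kk r)); have ha'' : 0 < aK a₀ (L : ℝ) (r + kk) * (((L ^ r * L ^ kk : ℕ) : ℝ)) ^ (d + 1) := (by positivity)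
  have haKabs : |aK a₀ (L : ℝ) kk| + |aK a₀ (L : ℝ) (r + kk)| ≤ 2 * a₀ := by rw [abs_of_pos haK, abs_of_pos haK']; linarith only [haKle, haKle']
  have hcNle : |aK a₀ (L : ℝ) kk * (((L ^ kk : ℕ) : ℝ)) ^ (d + 1)| * ((((L ^ kk : ℕ) : ℝ)) ^ (d + 1))⁻¹ * (2 * (π * (d + 1) / (L ^ mv : ℕ))) ≤ (π * (d + 1) / W * 0 + 2 * (π * (d + 1) / W)) * a₀ := by
    rw [abs_of_pos ha', mul_assoc (aK a₀ (L : ℝ) kk), mul_inv_cancel₀ (by positivity), mul_one, mul_zero, zero_add, mul_comm]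
    exact mul_le_mul_of_nonneg_left haKle (by positivity)
  have hcNle' : |aK a₀ (L : ℝ) (r + kk) * (((L ^ r * L ^ kk : ℕ) : ℝ)) ^ (d + 1)| * ((((L ^ r * L ^ kk : ℕ) : ℝ)) ^ (d + 1))⁻¹ * (2 * (π * (d + 1) / (L ^ mv : ℕ))) ≤ (π * (d + 1) / W * 0 + 2 * (π * (d + 1) / W)) * a₀ := by
    rw [abs_of_pos ha'', mul_assoc (aK a₀ (L : ℝ) (r + kk)), mul_inv_cancel₀ (by positivity), mul_one, mul_zero, zero_add, mul_comm]
    exact mul_le_mul_of_nonneg_left haKle' (by positivity)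
  obtain ⟨hG0, hGF, -, hGB, hG0', hGF', -, hGB', hDG, hDGF, -, hDGB⟩ := H kk hk r hr (mv + 1) (cvM d L mv kk hL) hMc ι
  -- the two-grid letter `(L^k)^{−1∕4}` and the size `S`
  let εk : ℝ := ((L : ℝ) ^ kk) ^ (-(1 / 4 : ℝ)); have hLk1 : (1 : ℝ) ≤ (L : ℝ) ^ kk := (by rw [← Nat.cast_pow]; exact hnR); have hεk0 : 0 ≤ εk := Real.rpow_nonneg (by positivity) _
  have hnε : (((L ^ kk : ℕ) : ℝ))⁻¹ ≤ εk := by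
    rw [Nat.cast_pow, ← Real.rpow_neg_one]; exact Real.rpow_le_rpow_of_exponent_le hLk1 (by norm_num)
  have hw1 : W⁻¹ ≤ 1 := inv_le_one_of_one_le₀ hW1
  have hnwε : ((((L ^ kk : ℕ) : ℝ)) * W)⁻¹ ≤ εk :=
    calc ((((L ^ kk : ℕ) : ℝ)) * W)⁻¹ = (((L ^ kk : ℕ) : ℝ))⁻¹ * W⁻¹ := by rw [mul_inv]
      _ ≤ (((L ^ kk : ℕ) : ℝ))⁻¹ * 1 := mul_le_mul_of_nonneg_left hw1 (by positivity)
      _ ≤ εk := by rw [mul_one]; exact hnε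
  have hn'ε : (((L ^ r * L ^ kk : ℕ) : ℝ))⁻¹ ≤ εk := (inv_anti₀ hnr hnn').trans hnε; let sS : ℝ := (1 + ρ) ^ ((d + 1) * (L ^ r - 1)) - 1; have hsS0 : 0 ≤ sS := (by have h1 := one_le_pow₀ (M₀ := ℝ) (a := 1 + ρ) (by linarith only [hρ0]) (n := (d + 1) * (L ^ r - 1)); show 0 ≤ (1 + ρ) ^ ((d + 1) * (L ^ r - 1)) - 1; linarith only [h1]); let Sdef : ℝ := εk + (o + (sS + rD)); have ho0 : 0 ≤ o := le_trans (by positivity) hole; have hεS : εk ≤ Sdef := (by show εk ≤ εk + (o + (sS + rD)); linarith only [ho0, hsS0, hrD])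
  -- the two-grid letters of the cover
  let O1 : ℝ := |W⁻¹| * (((L ^ kk : ℕ) : ℝ) * W)⁻¹ * (64 * π ^ 2 + π ^ 2 * Fintype.card (Fin (d + 1))); let O2 : ℝ := W⁻¹ ^ 2 * (((L ^ kk : ℕ) : ℝ) * W)⁻¹ * (144 * π ^ 3 + 32 * π ^ 3 * Fintype.card (Fin (d + 1)))
  let RNK : ℝ := (π * (d + 1) / (L ^ mv : ℕ) * (Real.exp 1 * (δm / 2))⁻¹ + 2 * (π * (d + 1) / (L ^ mv : ℕ))) * (4 / 3 * a₀ * ((L : ℝ) ^ kk) ^ (-(1 / 4 : ℝ))) +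
    2 * (π * (d + 1) / (((L ^ kk : ℕ) : ℝ) * (L ^ mv : ℕ))) * (|aK a₀ (L : ℝ) kk| + |aK a₀ (L : ℝ) (r + kk)|)
  have hoχ0 : 0 ≤ π * (d + 1) / (((L ^ kk : ℕ) : ℝ) * W) := div_nonneg (by positivity) (mul_nonneg hnr.le hWpos.le); have hoχ₂0 : 0 ≤ (W)⁻¹ * (((L ^ kk : ℕ) : ℝ) * W)⁻¹ * (32 * π ^ 4 + π ^ 2 * (d + 1)) := mul_nonneg (mul_nonneg (inv_nonneg.mpr hWpos.le) (inv_nonneg.mpr (mul_nonneg hnr.le hWpos.le))) (by positivity); have ho₁0 : 0 ≤ O1 := mul_nonneg (mul_nonneg (abs_nonneg _) (inv_nonneg.mpr (mul_nonneg hnr.le hWpos.le))) (by positivity); have ho₂0 : 0 ≤ O2 := mul_nonneg (mul_nonneg (pow_nonneg (inv_nonneg.mpr hWpos.le) 2) (inv_nonneg.mpr (mul_nonneg hnr.le hWpos.le))) (by positivity)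
  have hRNK0 : 0 ≤ RNK := (by positivity); have hℓ1 : π * (d + 1) / W ≤ π * (d + 1) := div_le_self (by positivity) hW1; have hLRb : π * (d + 1) / W * (Real.exp 1 * (δm / 2))⁻¹ + 2 * (π * (d + 1) / W) ≤ π * (d + 1) * E' + 2 * (π * (d + 1)) := add_le_add (mul_le_mul_of_nonneg_right hℓ1 hE'0) (by linarith only [hℓ1]); have hLR20 : 0 ≤ π * (d + 1) / W * (Real.exp 1 * (δm / 2))⁻¹ + 2 * (π * (d + 1) / W + π * (d + 1) / W * 1) := (by positivity)
  have hLRb2 : π * (d + 1) / W * (Real.exp 1 * (δm / 2))⁻¹ + 2 * (π * (d + 1) / W + π * (d + 1) / W * 1) ≤ π * (d + 1) * E' + 2 * (π * (d + 1) + π * (d + 1) * 1) := add_le_add (mul_le_mul_of_nonneg_right hℓ1 hE'0) (by linarith only [hℓ1]); have hcNb : (π * (d + 1) / W * 0 + 2 * (π * (d + 1) / W)) * a₀ ≤ (π * (d + 1) * 0 + 2 * (π * (d + 1))) * a₀ := mul_le_mul_of_nonneg_right (by linarith only [hℓ1]) ha₀.le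
  -- the windows of the cut box about the partition cell, radius 2, both grids
  have hwin2 : ∀ (μ : Fin (d + 1)) (k : Fin (d + 1) → ZMod (2 * L)) (p : ScX d L mv kk hL × ι), (∃ p₀ : ScX d L mv kk hL × ι, (p₀ = p ∨ p₀ = (fun μ => liftEquiv (scShift d L mv kk hL μ) ι) μ p ∨ p₀ = ((fun μ => liftEquiv (scShift d L mv kk hL μ) ι) μ).symm p) ∧ ∀ ν, |cenRep (2 * L) ((fun ν (p : ScX d L mv kk hL × ι) => scXi d L mv kk hL ν p.1) ν p₀ - ((k ν).val : ℝ))| < 2 + 1) → (fun p : ScX d L mv kk hL × ι => scChi d L mv kk hL k p.1) p = 1 := fun μ k p hp => scChi_lift_eq_one_of_near_bbox 2 ι hM hw hlo hhi hS6 μ k p hp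
  have hwin : ∀ (μ : Fin (d + 1)) (k : Fin (d + 1) → ZMod (2 * L)) (p : ScX d L mv kk hL × ι), (∃ p₀ : ScX d L mv kk hL × ι, (p₀ = p ∨ p₀ = (fun μ => liftEquiv (scShift d L mv kk hL μ) ι) μ p ∨ p₀ = ((fun μ => liftEquiv (scShift d L mv kk hL μ) ι) μ).symm p) ∧ ∀ ν, |cenRep (2 * L) ((fun ν (p : ScX d L mv kk hL × ι) => scXi d L mv kk hL ν p.1) ν p₀ - ((k ν).val : ℝ))| < 1) → (fun p : ScX d L mv kk hL × ι => scChi d L mv kk hL k p.1) p = 1 := fun μ k => hcubeWindow_of_bumpWindow (2 * L) (fun ν (p : ScX d L mv kk hL × ι) => scXi d L mv kk hL ν p.1) 2 (fun μ => liftEquiv (scShift d L mv kk hL μ) ι) μ (by norm_num) (hwin2 μ k)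
  have hwin2' : ∀ (μ : Fin (d + 1)) (k : Fin (d + 1) → ZMod (2 * L)) (p : ScX' d L mv kk r hL × ι), (∃ p₀ : ScX' d L mv kk r hL × ι, (p₀ = p ∨ p₀ = (fun μ => liftEquiv (scShift' d L mv kk r hL μ) ι) μ p ∨ p₀ = ((fun μ => liftEquiv (scShift' d L mv kk r hL μ) ι) μ).symm p) ∧ ∀ ν, |cenRep (2 * L) ((fun ν (p : ScX' d L mv kk r hL × ι) => scXi' d L mv kk r hL ν p.1) ν p₀ - ((k ν).val : ℝ))| < 2 + 1) → (fun p : ScX' d L mv kk r hL × ι => scChi' d L mv kk r hL k p.1) p = 1 := fun μ k p hp => scChi'_lift_eq_one_of_near_bbox 2 ι hM hw hlo hhi hS6 μ k p hp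
  have hwin' : ∀ (μ : Fin (d + 1)) (k : Fin (d + 1) → ZMod (2 * L)) (p : ScX' d L mv kk r hL × ι), (∃ p₀ : ScX' d L mv kk r hL × ι, (p₀ = p ∨ p₀ = (fun μ => liftEquiv (scShift' d L mv kk r hL μ) ι) μ p ∨ p₀ = ((fun μ => liftEquiv (scShift' d L mv kk r hL μ) ι) μ).symm p) ∧ ∀ ν, |cenRep (2 * L) ((fun ν (p : ScX' d L mv kk r hL × ι) => scXi' d L mv kk r hL ν p.1) ν p₀ - ((k ν).val : ℝ))| < 1) → (fun p : ScX' d L mv kk r hL × ι => scChi' d L mv kk r hL k p.1) p = 1 := fun μ k => hcubeWindow_of_bumpWindow (2 * L) (fun ν (p : ScX' d L mv kk r hL × ι) => scXi' d L mv kk r hL ν p.1) 2 (fun μ => liftEquiv (scShift' d L mv kk r hL μ) ι) μ (by norm_num) (hwin2' μ k)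
  -- the smallness (n15-c∕119 §3, as in n15-c∕262)
  have hq₀ : (β + (β₁ + π / W * β)) * (R * cr) * cr ≤ 1 / 2 := by
    have hπw : π / W ≤ π := div_le_self pi_pos.le hW1
    have h1 : (β + (β₁ + π / W * β)) * (R * cr) * cr ≤ (β + (β₁ + π * β)) * (R * cr) * cr := by
      have := mul_le_mul_of_nonneg_right hπw hβ0
      exact mul_le_mul_of_nonneg_right (mul_le_mul_of_nonneg_right (by linarith only [this]) (by positivity)) hcr0
    have h2 : (β + (β₁ + π * β)) * (R * cr) * cr = ((β + (β₁ + π * β)) * cr * cr) / (2 * ((β + (β₁ + π * β)) * cr * cr) + 1) := by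
      rw [hRdef]; ring
    have h3' : ((β + (β₁ + π * β)) * cr * cr) / (2 * ((β + (β₁ + π * β)) * cr * cr) + 1) ≤ 1 / 2 := by
      rw [div_le_iff₀ (by positivity)]
      have : 0 ≤ (β + (β₁ + π * β)) * cr * cr := by positivity
      linarith only [this]
    linarith only [h1, h2, h3']
  have hθsm : Nov * cr * (cι2 * (θ₀ * (2 * (β + (β₁ + π * β))) * cr)) ≤ 1 / 4 := by
    have hX : 0 ≤ Nov * cr * (cι2 * (2 * (β + (β₁ + π * β))) * cr) := by positivity
    have e1 : Nov * cr * (cι2 * (θ₀ * (2 * (β + (β₁ + π * β))) * cr)) = θ₀ * (Nov * cr * (cι2 * (2 * (β + (β₁ + π * β))) * cr)) := by ring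
    rw [e1, hθ₀def, div_mul_eq_mul_div, one_mul, div_le_iff₀ (by positivity)]
    linarith only [hX]
  have hsmall := cvSmall (Nov := Nov) (cr := cr) (cι2 := cι2) (cJ := (Fintype.card (Fin (d + 1)) : ℝ)) (β := β) (β₁ := β₁) (w := W) (R := R) (θF := θ₀) (ε₀ := 0)
    (ε := δm / 2) (E' := 0) (cN₀ := a₀) (D := (d : ℝ) + 1) (κ := 0)
    hNov0 hcr0 (by positivity) (by positivity) hβ0 hβ₁0 hW1 hR0.le hθ₀0.le (by positivity) le_rfl ha₀.le (by positivity) le_rfl hq₀ hθsm (by rw [zero_div]) hW0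
  have hhalf := cvSmallHalf (Nov := Nov) (cr := cr) (cι2 := cι2) (cJ := (Fintype.card (Fin (d + 1)) : ℝ)) (β := β) (β₁ := β₁) (w := W) (R := R) (θF := θ₀) (ε₀ := 0)
    (ε := δm / 2) (E' := 0) (cN₀ := a₀) (D := (d : ℝ) + 1) (κ := 0)
    hNov0 hcr0 (by positivity) (by positivity) hβ0 hβ₁0 hW1 hR0.le hθ₀0.le (by positivity) le_rfl ha₀.le (by positivity) le_rfl hq₀ hθsm (by rw [zero_div]) hW0
  -- the `κ·S` bounds of the two-grid letters
  have hsoχ : π * (d + 1) / (((L ^ kk : ℕ) : ℝ) * W) ≤ π * (d + 1) * Sdef := by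
    rw [div_eq_mul_inv]; exact mul_le_mul_of_nonneg_left (hnwε.trans hεS) (by positivity)
  have hsoχ₁ : 2 * (π * (d + 1) / (((L ^ kk : ℕ) : ℝ) * W)) ≤ 2 * (π * (d + 1)) * Sdef := by
    rw [mul_assoc]; exact mul_le_mul_of_nonneg_left hsoχ zero_le_two
  have hsoχ₂ : (W)⁻¹ * (((L ^ kk : ℕ) : ℝ) * W)⁻¹ * (32 * π ^ 4 + π ^ 2 * (d + 1)) ≤ (32 * π ^ 4 + π ^ 2 * (d + 1)) * Sdef :=
    calc (W)⁻¹ * (((L ^ kk : ℕ) : ℝ) * W)⁻¹ * (32 * π ^ 4 + π ^ 2 * (d + 1)) ≤ 1 * Sdef * (32 * π ^ 4 + π ^ 2 * (d + 1)) := mul_le_mul_of_nonneg_right (mul_le_mul hw1 (hnwε.trans hεS) (inv_nonneg.mpr (mul_nonneg hnr.le hWpos.le)) zero_le_one) (by positivity)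
      _ = (32 * π ^ 4 + π ^ 2 * (d + 1)) * Sdef := by ring
  have hwabs : |W⁻¹| ≤ 1 := by rw [abs_of_nonneg (inv_nonneg.mpr hWpos.le)]; exact hw1
  have hso₁ : O1 ≤ (64 * π ^ 2 + π ^ 2 * Fintype.card (Fin (d + 1))) * Sdef :=
    calc O1 ≤ 1 * Sdef * (64 * π ^ 2 + π ^ 2 * Fintype.card (Fin (d + 1))) := mul_le_mul_of_nonneg_right (mul_le_mul hwabs (hnwε.trans hεS) (inv_nonneg.mpr (mul_nonneg hnr.le hWpos.le)) zero_le_one) (by positivity)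
      _ = (64 * π ^ 2 + π ^ 2 * Fintype.card (Fin (d + 1))) * Sdef := by ring
  have hso₂ : O2 ≤ (144 * π ^ 3 + 32 * π ^ 3 * Fintype.card (Fin (d + 1))) * Sdef :=
    calc O2 ≤ 1 * Sdef * (144 * π ^ 3 + 32 * π ^ 3 * Fintype.card (Fin (d + 1))) := mul_le_mul_of_nonneg_right (mul_le_mul (pow_le_one₀ (inv_nonneg.mpr hWpos.le) hw1) (hnwε.trans hεS) (inv_nonneg.mpr (mul_nonneg hnr.le hWpos.le)) zero_le_one) (by positivity)
      _ = (144 * π ^ 3 + 32 * π ^ 3 * Fintype.card (Fin (d + 1))) * Sdef := by ring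
  have hso : o ≤ 1 * Sdef := (by show o ≤ 1 * (εk + (o + (sS + rD))); linarith only [hεk0, hsS0, hrD]); have hss : sS ≤ 1 * Sdef := (by show sS ≤ 1 * (εk + (o + (sS + rD))); linarith only [hεk0, ho0, hrD]); have hsrD : rD ≤ 1 * Sdef := (by show rD ≤ 1 * (εk + (o + (sS + rD))); linarith only [hεk0, ho0, hsS0]); have hsm₀ : C * εk ≤ C * Sdef := mul_le_mul_of_nonneg_left hεS hC.le
  have hsRN : RNK ≤ KRN * Sdef := by
    have h1 : (π * (d + 1) / (L ^ mv : ℕ) * (Real.exp 1 * (δm / 2))⁻¹ + 2 * (π * (d + 1) / (L ^ mv : ℕ))) * (4 / 3 * a₀ * ((L : ℝ) ^ kk) ^ (-(1 / 4 : ℝ))) ≤ (π * (d + 1) * E' + 2 * (π * (d + 1))) * (4 / 3 * a₀ * Sdef) := mul_le_mul hLRb (mul_le_mul_of_nonneg_left hεS (by positivity)) (by positivity) (by positivity)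
    have h2 : 2 * (π * (d + 1) / (((L ^ kk : ℕ) : ℝ) * (L ^ mv : ℕ))) * (|aK a₀ (L : ℝ) kk| + |aK a₀ (L : ℝ) (r + kk)|) ≤ 2 * (π * (d + 1) * Sdef) * (2 * a₀) := mul_le_mul (mul_le_mul_of_nonneg_left hsoχ zero_le_two) haKabs (by positivity) (by positivity)
    calc RNK ≤ (π * (d + 1) * E' + 2 * (π * (d + 1))) * (4 / 3 * a₀ * Sdef) + 2 * (π * (d + 1) * Sdef) * (2 * a₀) := add_le_add h1 h2
      _ = ((π * (d + 1) * E' + 2 * (π * (d + 1))) * (4 / 3 * a₀) + 2 * (π * (d + 1)) * (2 * a₀)) * Sdef := by ring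
  have hsDη0 : (π / W) / η⁻¹ ≤ π * Sdef := by
    rw [hηinv, div_eq_mul_inv]; exact mul_le_mul (div_le_self pi_pos.le hW1) (hnε.trans hεS) (inv_nonneg.mpr hnr.le) pi_pos.le
  have hsDη1 : (π / W) / η'⁻¹ ≤ π * Sdef := by
    rw [hη'inv, div_eq_mul_inv]; exact mul_le_mul (div_le_self pi_pos.le hW1) (hn'ε.trans hεS) (inv_nonneg.mpr hnr'.le) pi_pos.le
  -- the nonnegativity of the two-grid cut kernel, the fine block map read through the pairing, the partition's support inside the box
  have hKc : ∀ (y y' : Tor (cvM d L mv kk hL)), 0 ≤ C * ((L : ℝ) ^ kk) ^ (-(1 / 4 : ℝ)) * Real.exp (-(δm * tdistT (cvM d L mv kk hL) y y')) := fun y y' => mul_nonneg (mul_nonneg hC.le hεk0) (Real.exp_nonneg _); have hblk' : liftBlk (scBlk' d L mv kk r hL) ι = liftBlk (scBlk d L mv kk hL ∘ kingPr L kk r (cvM d L mv kk hL)) ι := funext fun p => (blockOf_kingPr (cvM d L mv kk hL) L kk r p.1).symm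
  have hhχ : ∀ (k : Fin (d + 1) → ZMod (2 * L)) (x : ScX d L mv kk hL), scH d L mv kk hL k x ≠ 0 → scChi d L mv kk hL k x ≠ 0 := fun k x hx => by
    have h := chiCube_box_eq_one_of_coverH_ne_zero (n := L ^ kk) hM hw hS6 0 k (x := (x, (0 : Fin (d + 1)))) (Or.inl rfl) hx
    rw [show scChi d L mv kk hL k x = chiCube (cvM d L mv kk hL) (L ^ kk) (coverCorner (cvM d L mv kk hL) (L ^ mv) L (2 * L ^ mv) k) (6 * L ^ mv + 1) (x, 0) from rfl, h]
    exact one_ne_zero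
  -- 335's rows at the cover, by name
  have hrow : RowSum (unitTorusGeo L kk (cvM d L mv kk hL)) (δm / 32) cr := (by rw [hcr_def]; exact rowSum_unitTorusGeo L kk _ (by positivity)); have hdχt : ∀ k, ∀ μ p, |fgrad η⁻¹ (liftEquiv (scShift d L mv kk hL μ) ι) (fun p : ScX d L mv kk hL × ι => (scBump d L mv kk hL k) p.1) p| ≤ (π / W) := (by rw [hηinv]; exact fun k μ p => (abs_fgrad_bcube_le (2 * L) (fun ν (p : ScX d L mv kk hL × ι) => scXi d L mv kk hL ν p.1) 2 (fun μ => liftEquiv (scShift d L mv kk hL μ) ι) hK0 hξS _ k μ p).trans hsW.le)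
  have hdχtb : ∀ k, ∀ μ p, |bgrad η⁻¹ (liftEquiv (scShift d L mv kk hL μ) ι) (fun p : ScX d L mv kk hL × ι => (scBump d L mv kk hL k) p.1) p| ≤ (π / W) := by rw [hηinv]; exact fun k μ p => (abs_bgrad_bcube_le (2 * L) (fun ν (p : ScX d L mv kk hL × ι) => scXi d L mv kk hL ν p.1) 2 (fun μ => liftEquiv (scShift d L mv kk hL μ) ι) hK0 hξS _ k μ p).trans hsW.le
  have hsub : ∀ k, mulOp (fun p : ScX d L mv kk hL × ι => (scBump d L mv kk hL k) p.1) ∘ₗ mulOp (fun p : ScX d L mv kk hL × ι => (scChi d L mv kk hL k) p.1) = mulOp (fun p : ScX d L mv kk hL × ι => (scBump d L mv kk hL k) p.1) := fun k => bcube_cut (2 * L) (fun ν (p : ScX d L mv kk hL × ι) => scXi d L mv kk hL ν p.1) 2 (fun μ => liftEquiv (scShift d L mv kk hL μ) ι) 0 (hwin2 0 k)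
  have hχ : ∀ k, mulOp (fun p : ScX d L mv kk hL × ι => (scChi d L mv kk hL k) p.1) ∘ₗ mulOp (fun p : ScX d L mv kk hL × ι => (scBump d L mv kk hL k) p.1) = mulOp (fun p : ScX d L mv kk hL × ι => (scBump d L mv kk hL k) p.1) := fun k => cut_bcube (2 * L) (fun ν (p : ScX d L mv kk hL × ι) => scXi d L mv kk hL ν p.1) 2 (fun μ => liftEquiv (scShift d L mv kk hL μ) ι) 0 (hwin2 0 k)
  have hs : ∀ k, ∀ μ, mulOp ((fun p : ScX d L mv kk hL × ι => (scBump d L mv kk hL k) p.1) ∘ (liftEquiv (scShift d L mv kk hL μ) ι)) ∘ₗ mulOp (fun p : ScX d L mv kk hL × ι => (scChi d L mv kk hL k) p.1) = mulOp ((fun p : ScX d L mv kk hL × ι => (scBump d L mv kk hL k) p.1) ∘ (liftEquiv (scShift d L mv kk hL μ) ι)) := fun k μ => bcube_comp_shift_cut (2 * L) (fun ν (p : ScX d L mv kk hL × ι) => scXi d L mv kk hL ν p.1) 2 (fun μ => liftEquiv (scShift d L mv kk hL μ) ι) μ (hwin2 μ k)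
  have hsb : ∀ k, ∀ μ, mulOp ((fun p : ScX d L mv kk hL × ι => (scBump d L mv kk hL k) p.1) ∘ (liftEquiv (scShift d L mv kk hL μ) ι).symm) ∘ₗ mulOp (fun p : ScX d L mv kk hL × ι => (scChi d L mv kk hL k) p.1) = mulOp ((fun p : ScX d L mv kk hL × ι => (scBump d L mv kk hL k) p.1) ∘ (liftEquiv (scShift d L mv kk hL μ) ι).symm) := fun k μ => bcube_comp_shift_symm_cut (2 * L) (fun ν (p : ScX d L mv kk hL × ι) => scXi d L mv kk hL ν p.1) 2 (fun μ => liftEquiv (scShift d L mv kk hL μ) ι) μ (hwin2 μ k)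
  have hdd : ∀ k, ∀ μ, mulOp (fgrad η⁻¹ (liftEquiv (scShift d L mv kk hL μ) ι) (fun p : ScX d L mv kk hL × ι => (scBump d L mv kk hL k) p.1)) ∘ₗ mulOp (fun p : ScX d L mv kk hL × ι => (scChi d L mv kk hL k) p.1) = mulOp (fgrad η⁻¹ (liftEquiv (scShift d L mv kk hL μ) ι) (fun p : ScX d L mv kk hL × ι => (scBump d L mv kk hL k) p.1)) := fun k μ => fgrad_bcube_cut (2 * L) (fun ν (p : ScX d L mv kk hL × ι) => scXi d L mv kk hL ν p.1) 2 (fun μ => liftEquiv (scShift d L mv kk hL μ) ι) μ η⁻¹ (hwin2 μ k)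
  have hddb : ∀ k, ∀ μ, mulOp (bgrad η⁻¹ (liftEquiv (scShift d L mv kk hL μ) ι) (fun p : ScX d L mv kk hL × ι => (scBump d L mv kk hL k) p.1)) ∘ₗ mulOp (fun p : ScX d L mv kk hL × ι => (scChi d L mv kk hL k) p.1) = mulOp (bgrad η⁻¹ (liftEquiv (scShift d L mv kk hL μ) ι) (fun p : ScX d L mv kk hL × ι => (scBump d L mv kk hL k) p.1)) := fun k μ => bgrad_bcube_cut (2 * L) (fun ν (p : ScX d L mv kk hL × ι) => scXi d L mv kk hL ν p.1) 2 (fun μ => liftEquiv (scShift d L mv kk hL μ) ι) μ η⁻¹ (hwin2 μ k)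
  have hNψ : ∀ k, (scCube d L mv kk hL (aK a₀ (L : ℝ) kk * (((L ^ kk : ℕ) : ℝ)) ^ (d + 1)) ι k) ∘ₗ mulOp (fun p : ScX d L mv kk hL × ι => (scPsi d L mv kk hL k) p.1) = (scCube d L mv kk hL (aK a₀ (L : ℝ) kk * (((L ^ kk : ℕ) : ℝ)) ^ (d + 1)) ι k) := fun k => scCube_comp_mulOp_scPsi ι _ k
  have hdχt' : ∀ k, ∀ μ p', |fgrad η'⁻¹ (liftEquiv (scShift' d L mv kk r hL μ) ι) (fun p' : ScX' d L mv kk r hL × ι => (scBump' d L mv kk r hL k) p'.1) p'| ≤ (π / W) := by rw [hη'inv]; exact fun k μ p => (abs_fgrad_bcube_le (2 * L) (fun ν (p : ScX' d L mv kk r hL × ι) => scXi' d L mv kk r hL ν p.1) 2 (fun μ => liftEquiv (scShift' d L mv kk r hL μ) ι) hK0 hξS' _ k μ p).trans hsW'.le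
  have hdχtb' : ∀ k, ∀ μ p', |bgrad η'⁻¹ (liftEquiv (scShift' d L mv kk r hL μ) ι) (fun p' : ScX' d L mv kk r hL × ι => (scBump' d L mv kk r hL k) p'.1) p'| ≤ (π / W) := by rw [hη'inv]; exact fun k μ p => (abs_bgrad_bcube_le (2 * L) (fun ν (p : ScX' d L mv kk r hL × ι) => scXi' d L mv kk r hL ν p.1) 2 (fun μ => liftEquiv (scShift' d L mv kk r hL μ) ι) hK0 hξS' _ k μ p).trans hsW'.le
  have hsub' : ∀ k, mulOp (fun p : ScX' d L mv kk r hL × ι => (scBump' d L mv kk r hL k) p.1) ∘ₗ mulOp (fun p : ScX' d L mv kk r hL × ι => (scChi' d L mv kk r hL k) p.1) = mulOp (fun p : ScX' d L mv kk r hL × ι => (scBump' d L mv kk r hL k) p.1) := fun k => bcube_cut (2 * L) (fun ν (p : ScX' d L mv kk r hL × ι) => scXi' d L mv kk r hL ν p.1) 2 (fun μ => liftEquiv (scShift' d L mv kk r hL μ) ι) 0 (hwin2' 0 k)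
  have hχ' : ∀ k, mulOp (fun p : ScX' d L mv kk r hL × ι => (scChi' d L mv kk r hL k) p.1) ∘ₗ mulOp (fun p : ScX' d L mv kk r hL × ι => (scBump' d L mv kk r hL k) p.1) = mulOp (fun p : ScX' d L mv kk r hL × ι => (scBump' d L mv kk r hL k) p.1) := fun k => cut_bcube (2 * L) (fun ν (p : ScX' d L mv kk r hL × ι) => scXi' d L mv kk r hL ν p.1) 2 (fun μ => liftEquiv (scShift' d L mv kk r hL μ) ι) 0 (hwin2' 0 k)
  have hs' : ∀ k, ∀ μ, mulOp ((fun p' : ScX' d L mv kk r hL × ι => (scBump' d L mv kk r hL k) p'.1) ∘ (liftEquiv (scShift' d L mv kk r hL μ) ι)) ∘ₗ mulOp (fun p' : ScX' d L mv kk r hL × ι => (scChi' d L mv kk r hL k) p'.1) = mulOp ((fun p' : ScX' d L mv kk r hL × ι => (scBump' d L mv kk r hL k) p'.1) ∘ (liftEquiv (scShift' d L mv kk r hL μ) ι)) := fun k μ => bcube_comp_shift_cut (2 * L) (fun ν (p : ScX' d L mv kk r hL × ι) => scXi' d L mv kk r hL ν p.1) 2 (fun μ => liftEquiv (scShift' d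 L mv kk r hL μ) ι) μ (hwin2' μ k)
  have hsb' : ∀ k, ∀ μ, mulOp ((fun p' : ScX' d L mv kk r hL × ι => (scBump' d L mv kk r hL k) p'.1) ∘ (liftEquiv (scShift' d L mv kk r hL μ) ι).symm) ∘ₗ mulOp (fun p' : ScX' d L mv kk r hL × ι => (scChi' d L mv kk r hL k) p'.1) = mulOp ((fun p' : ScX' d L mv kk r hL × ι => (scBump' d L mv kk r hL k) p'.1) ∘ (liftEquiv (scShift' d L mv kk r hL μ) ι).symm) := fun k μ => bcube_comp_shift_symm_cut (2 * L) (fun ν (p : ScX' d L mv kk r hL × ι) => scXi' d L mv kk r hL ν p.1) 2 (fun μ => liftEquiv (scShift' d L mv kk r hL μ) ι) μ (hwin2' μ k)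
  have hdd' : ∀ k, ∀ μ, mulOp (fgrad η'⁻¹ (liftEquiv (scShift' d L mv kk r hL μ) ι) (fun p' : ScX' d L mv kk r hL × ι => (scBump' d L mv kk r hL k) p'.1)) ∘ₗ mulOp (fun p' : ScX' d L mv kk r hL × ι => (scChi' d L mv kk r hL k) p'.1) = mulOp (fgrad η'⁻¹ (liftEquiv (scShift' d L mv kk r hL μ) ι) (fun p' : ScX' d L mv kk r hL × ι => (scBump' d L mv kk r hL k) p'.1)) := fun k μ => fgrad_bcube_cut (2 * L) (fun ν (p : ScX' d L mv kk r hL × ι) => scXi' d L mv kk r hL ν p.1) 2 (fun μ => liftEquiv (scShift' d L mv kk r hL μ) ι) μ η'⁻¹ (hwin2' μ k)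
  have hddb' : ∀ k, ∀ μ, mulOp (bgrad η'⁻¹ (liftEquiv (scShift' d L mv kk r hL μ) ι) (fun p' : ScX' d L mv kk r hL × ι => (scBump' d L mv kk r hL k) p'.1)) ∘ₗ mulOp (fun p' : ScX' d L mv kk r hL × ι => (scChi' d L mv kk r hL k) p'.1) = mulOp (bgrad η'⁻¹ (liftEquiv (scShift' d L mv kk r hL μ) ι) (fun p' : ScX' d L mv kk r hL × ι => (scBump' d L mv kk r hL k) p'.1)) := fun k μ => bgrad_bcube_cut (2 * L) (fun ν (p : ScX' d L mv kk r hL × ι) => scXi' d L mv kk r hL ν p.1) 2 (fun μ => liftEquiv (scShift' d L mv kk r hL μ) ι) μ η'⁻¹ (hwin2' μ k)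
  have hNψ' : ∀ k, (scCube' d L mv kk r hL (aK a₀ (L : ℝ) (r + kk) * (((L ^ r * L ^ kk : ℕ) : ℝ)) ^ (d + 1)) ι k) ∘ₗ mulOp (fun p : ScX' d L mv kk r hL × ι => (scPsi' d L mv kk r hL k) p.1) = (scCube' d L mv kk r hL (aK a₀ (L : ℝ) (r + kk) * (((L ^ r * L ^ kk : ℕ) : ℝ)) ^ (d + 1)) ι k) := fun k => scCube'_comp_mulOp_scPsi' ι _ k; have hfitχ : ∀ k, ∀ x', |(scBump' d L mv kk r hL k) x' - (scBump d L mv kk hL k) ((kingPr L kk r (cvM d L mv kk hL)) x')| ≤ (π * (d + 1) / (((L ^ kk : ℕ) : ℝ) * W)) := fun k x' => abs_scBump'_sub_scBump_kingPr_le hM hw k x'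
  have hfit₁ : ∀ k, ∀ μ p', |((fun p' : ScX' d L mv kk r hL × ι => (scBump' d L mv kk r hL k) p'.1) ∘ (liftEquiv (scShift' d L mv kk r hL μ) ι)) p' - ((fun p : ScX d L mv kk hL × ι => (scBump d L mv kk hL k) p.1) ∘ (liftEquiv (scShift d L mv kk hL μ) ι)) (liftMap (kingPr L kk r (cvM d L mv kk hL)) ι p')| ≤ (2 * (π * (d + 1) / (((L ^ kk : ℕ) : ℝ) * W))) := fun k μ p' => abs_scBump'_scShift'_sub_le ι hM hw k μ p'
  have hfit₁b : ∀ k, ∀ μ p', |((fun p' : ScX' d L mv kk r hL × ι => (scBump' d L mv kk r hL k) p'.1) ∘ (liftEquiv (scShift' d L mv kk r hL μ) ι).symm) p' - ((fun p : ScX d L mv kk hL × ι => (scBump d L mv kk hL k) p.1) ∘ (liftEquiv (scShift d L mv kk hL μ) ι).symm) (liftMap (kingPr L kk r (cvM d L mv kk hL)) ι p')| ≤ (2 * (π * (d + 1) / (((L ^ kk : ℕ) : ℝ) * W))) := fun k μ p' => abs_scBump'_scShift'_symm_sub_le ι hM hw k μ p'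
  have hfit₂ : ∀ k, ∀ μ p', |fgrad η'⁻¹ (liftEquiv (scShift' d L mv kk r hL μ) ι) (fun p' : ScX' d L mv kk r hL × ι => (scBump' d L mv kk r hL k) p'.1) p' - fgrad η⁻¹ (liftEquiv (scShift d L mv kk hL μ) ι) (fun p : ScX d L mv kk hL × ι => (scBump d L mv kk hL k) p.1) (liftMap (kingPr L kk r (cvM d L mv kk hL)) ι p')| ≤ ((W)⁻¹ * (((L ^ kk : ℕ) : ℝ) * W)⁻¹ * (32 * π ^ 4 + π ^ 2 * (d + 1))) := by rw [hηinv, hη'inv]; exact fun k μ p' => abs_fgrad_scBump'_sub_le ι hM hw hL4 k μ p'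
  have hfit₂b : ∀ k, ∀ μ p', |bgrad η'⁻¹ (liftEquiv (scShift' d L mv kk r hL μ) ι) (fun p' : ScX' d L mv kk r hL × ι => (scBump' d L mv kk r hL k) p'.1) p' - bgrad η⁻¹ (liftEquiv (scShift d L mv kk hL μ) ι) (fun p : ScX d L mv kk hL × ι => (scBump d L mv kk hL k) p.1) (liftMap (kingPr L kk r (cvM d L mv kk hL)) ι p')| ≤ ((W)⁻¹ * (((L ^ kk : ℕ) : ℝ) * W)⁻¹ * (32 * π ^ 4 + π ^ 2 * (d + 1))) := by rw [hηinv, hη'inv]; exact fun k μ p' => abs_bgrad_scBump'_sub_le ι hM hw hL4 k μ p'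
  have hcut : ∀ k, HasMaj (ScNorm d L mv kk hL ι) (ScNorm d L mv kk hL ι) (mulOp (fun p : ScX d L mv kk hL × ι => (scChi d L mv kk hL k) p.1) ∘ₗ (scCube d L mv kk hL (aK a₀ (L : ℝ) kk * (((L ^ kk : ℕ) : ℝ)) ^ (d + 1)) ι k)) (fun y y' => ind (g := unitTorusGeo L kk (cvM d L mv kk hL)) (cvSk d L mv kk hL k) y * ind (g := unitTorusGeo L kk (cvM d L mv kk hL)) (cvSk d L mv kk hL k) y' * (β * Real.exp (-(δm * (unitTorusGeo L kk (cvM d L mv kk hL)).dist y y')))) := fun k => hasMaj_cut_scCube ι hM hm₁ hfitI hS0 hC.le hG0 k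
  have hcutF : ∀ k, ∀ μ, HasMaj (ScNorm d L mv kk hL ι) (ScNorm d L mv kk hL ι) (mulOp (fun p : ScX d L mv kk hL × ι => (scChi d L mv kk hL k) p.1) ∘ₗ (fgrad η⁻¹ (liftEquiv (scShift d L mv kk hL μ) ι) ∘ₗ (scCube d L mv kk hL (aK a₀ (L : ℝ) kk * (((L ^ kk : ℕ) : ℝ)) ^ (d + 1)) ι k))) (fun y y' => ind (g := unitTorusGeo L kk (cvM d L mv kk hL)) (cvSk d L mv kk hL k) y * ind (g := unitTorusGeo L kk (cvM d L mv kk hL)) (cvSk d L mv kk hL k) y' * (β₁ * Real.exp (-(δm * (unitTorusGeo L kk (cvM d L mv kk hL)).dist y y')))) := fun k μ => hasMaj_cutF_scCube ι hM hm₁ hfitI hS0 hC μ hGF k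
  have hcutB : ∀ k, ∀ μ, HasMaj (ScNorm d L mv kk hL ι) (ScNorm d L mv kk hL ι) (mulOp (fun p : ScX d L mv kk hL × ι => (scChi d L mv kk hL k) p.1) ∘ₗ (bgrad η⁻¹ (liftEquiv (scShift d L mv kk hL μ) ι) ∘ₗ (scCube d L mv kk hL (aK a₀ (L : ℝ) kk * (((L ^ kk : ℕ) : ℝ)) ^ (d + 1)) ι k))) (fun y y' => ind (g := unitTorusGeo L kk (cvM d L mv kk hL)) (cvSk d L mv kk hL k) y * ind (g := unitTorusGeo L kk (cvM d L mv kk hL)) (cvSk d L mv kk hL k) y' * (β₁ * Real.exp (-(δm * (unitTorusGeo L kk (cvM d L mv kk hL)).dist y y')))) := fun k μ => hasMaj_cutB_scCube ι hM hm₁ hfitI hS0 hC μ hGB k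
  have hcut' : ∀ k, HasMaj (BlockNorm.ofBlocks (unitTorusGeo L kk (cvM d L mv kk hL)) (liftBlk (scBlk d L mv kk hL ∘ kingPr L kk r (cvM d L mv kk hL)) ι)) (BlockNorm.ofBlocks (unitTorusGeo L kk (cvM d L mv kk hL)) (liftBlk (scBlk d L mv kk hL ∘ kingPr L kk r (cvM d L mv kk hL)) ι)) (mulOp (fun p : ScX' d L mv kk r hL × ι => (scChi' d L mv kk r hL k) p.1) ∘ₗ (scCube' d L mv kk r hL (aK a₀ (L : ℝ) (r + kk) * (((L ^ r * L ^ kk : ℕ) : ℝ)) ^ (d + 1)) ι k)) (fun y y' => ind (g := unitTorusGeo L kk (cvM d L mv kk hL)) (cvSk d L mv kk hL k) y * ind (g := unitTorusGeo L kk (cvM d L mv kk hL)) (cvSk d L mv kk hL k) y' * (β * Real.exp (-(δm * (unitTorusGeo L kk (cvM d L mv kk hL)).dist y y')))) := fun k => hasMaj_src_tgt_congr hblk' (hasMaj_cut_scCube' ι hM hm₁ hfitI hS0 hC.le hG0' k)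
  have hcutF' : ∀ k, ∀ μ, HasMaj (BlockNorm.ofBlocks (unitTorusGeo L kk (cvM d L mv kk hL)) (liftBlk (scBlk d L mv kk hL ∘ kingPr L kk r (cvM d L mv kk hL)) ι)) (BlockNorm.ofBlocks (unitTorusGeo L kk (cvM d L mv kk hL)) (liftBlk (scBlk d L mv kk hL ∘ kingPr L kk r (cvM d L mv kk hL)) ι)) (mulOp (fun p : ScX' d L mv kk r hL × ι => (scChi' d L mv kk r hL k) p.1) ∘ₗ (fgrad η'⁻¹ (liftEquiv (scShift' d L mv kk r hL μ) ι) ∘ₗ (scCube' d L mv kk r hL (aK a₀ (L : ℝ) (r + kk) * (((L ^ r * L ^ kk : ℕ) : ℝ)) ^ (d + 1)) ι k))) (fun y y' => ind (g := unitTorusGeo L kk (cvM d L mv kk hL)) (cvSk d L mv kk hL k) y * ind (g := unitTorusGeo L kk (cvM d L mv kk hL)) (cvSk d L mv kk hL k) y' * (β₁ * Real.exp (-(δm * (unitTorusGeo L kk (cvM d L mv kk hL)).dist y y')))) := fun k μ => hasMaj_src_tgt_congr hblk' (hasMaj_cutF_scCube' ι hM hm₁ hfitI hS0 hC μ hGF'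 k)
  have hcutB' : ∀ k, ∀ μ, HasMaj (BlockNorm.ofBlocks (unitTorusGeo L kk (cvM d L mv kk hL)) (liftBlk (scBlk d L mv kk hL ∘ kingPr L kk r (cvM d L mv kk hL)) ι)) (BlockNorm.ofBlocks (unitTorusGeo L kk (cvM d L mv kk hL)) (liftBlk (scBlk d L mv kk hL ∘ kingPr L kk r (cvM d L mv kk hL)) ι)) (mulOp (fun p : ScX' d L mv kk r hL × ι => (scChi' d L mv kk r hL k) p.1) ∘ₗ (bgrad η'⁻¹ (liftEquiv (scShift' d L mv kk r hL μ) ι) ∘ₗ (scCube' d L mv kk r hL (aK a₀ (L : ℝ) (r + kk) * (((L ^ r * L ^ kk : ℕ) : ℝ)) ^ (d + 1)) ι k))) (fun y y' => ind (g := unitTorusGeo L kk (cvM d L mv kk hL)) (cvSk d L mv kk hL k) y * ind (g := unitTorusGeo L kk (cvM d L mv kk hL)) (cvSk d L mv kk hL k) y' * (β₁ * Real.exp (-(δm * (unitTorusGeo L kk (cvM d L mv kk hL)).dist y y')))) := fun k μ => hasMaj_src_tgt_congr hblk' (hasMaj_cutB_scCube' ι hM hm₁ hfitI hS0 hC μ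 hGB' k)
  have hDcut : ∀ k, HasMaj (ScNorm d L mv kk hL ι) (BlockNorm.ofBlocks (unitTorusGeo L kk (cvM d L mv kk hL)) (liftBlk (scBlk d L mv kk hL) ι ∘ liftMap (kingPr L kk r (cvM d L mv kk hL)) ι)) (idef (pull (liftMap (kingPr L kk r (cvM d L mv kk hL)) ι)) (pull (liftMap (kingPr L kk r (cvM d L mv kk hL)) ι)) (mulOp (fun p : ScX' d L mv kk r hL × ι => (scChi' d L mv kk r hL k) p.1) ∘ₗ (scCube' d L mv kk r hL (aK a₀ (L : ℝ) (r + kk) * (((L ^ r * L ^ kk : ℕ) : ℝ)) ^ (d + 1)) ι k)) (mulOp (fun p : ScX d L mv kk hL × ι => (scChi d L mv kk hL k) p.1) ∘ₗ (scCube d L mv kk hL (aK a₀ (L : ℝ) kk * (((L ^ kk : ℕ) : ℝ)) ^ (d + 1)) ι k))) (fun y y' => ind (g := unitTorusGeo L kk (cvM d L mv kk hL)) (cvSk d L mv kk hL k) y * ind (g := unitTorusGeo L kk (cvM d L mv kk hL)) (cvSk d L mv kk hL k) y' * ((C * εk) * Real.exp (-(δm * (unitTorusGeo L kk (cvM d L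 mv kk hL)).dist y y')))) := fun k => hasMaj_idef_cut_scCube ι hM hm₁ hfitI hS0 hKc hDG k
  have hDcutF : ∀ k, ∀ μ, HasMaj (ScNorm d L mv kk hL ι) (BlockNorm.ofBlocks (unitTorusGeo L kk (cvM d L mv kk hL)) (liftBlk (scBlk d L mv kk hL) ι ∘ liftMap (kingPr L kk r (cvM d L mv kk hL)) ι)) (idef (pull (liftMap (kingPr L kk r (cvM d L mv kk hL)) ι)) (pull (liftMap (kingPr L kk r (cvM d L mv kk hL)) ι)) (mulOp (fun p : ScX' d L mv kk r hL × ι => (scChi' d L mv kk r hL k) p.1) ∘ₗ (fgrad η'⁻¹ (liftEquiv (scShift' d L mv kk r hL μ) ι) ∘ₗ (scCube' d L mv kk r hL (aK a₀ (L : ℝ) (r + kk) * (((L ^ r * L ^ kk : ℕ) : ℝ)) ^ (d + 1)) ι k))) (mulOp (fun p : ScX d L mv kk hL × ι => (scChi d L mv kk hL k) p.1) ∘ₗ (fgrad η⁻¹ (liftEquiv (scShift d L mv kk hL μ) ι) ∘ₗ (scCube d L mv kk hL (aK a₀ (L : ℝ) kk * (((L ^ kk : ℕ) : ℝ)) ^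 (d + 1)) ι k)))) (fun y y' => ind (g := unitTorusGeo L kk (cvM d L mv kk hL)) (cvSk d L mv kk hL k) y * ind (g := unitTorusGeo L kk (cvM d L mv kk hL)) (cvSk d L mv kk hL k) y' * ((C * εk) * Real.exp (-(δm * (unitTorusGeo L kk (cvM d L mv kk hL)).dist y y')))) := fun k μ => hasMaj_idef_cutF_scCube ι hM hm₁ hfitI hS0 hKc μ hDGF k
  have hDcutB : ∀ k, ∀ μ, HasMaj (ScNorm d L mv kk hL ι) (BlockNorm.ofBlocks (unitTorusGeo L kk (cvM d L mv kk hL)) (liftBlk (scBlk d L mv kk hL) ι ∘ liftMap (kingPr L kk r (cvM d L mv kk hL)) ι)) (idef (pull (liftMap (kingPr L kk r (cvM d L mv kk hL)) ι)) (pull (liftMap (kingPr L kk r (cvM d L mv kk hL)) ι)) (mulOp (fun p : ScX' d L mv kk r hL × ι => (scChi' d L mv kk r hL k) p.1) ∘ₗ (bgrad η'⁻¹ (liftEquiv (scShift' d L mv kk r hL μ) ι) ∘ₗ (scCube' d L mv kk r hL (aK a₀ (L : ℝ) (r + kk) * (((L ^ r * L ^ kk : ℕ) : ℝ)) ^ (d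 + 1)) ι k))) (mulOp (fun p : ScX d L mv kk hL × ι => (scChi d L mv kk hL k) p.1) ∘ₗ (bgrad η⁻¹ (liftEquiv (scShift d L mv kk hL μ) ι) ∘ₗ (scCube d L mv kk hL (aK a₀ (L : ℝ) kk * (((L ^ kk : ℕ) : ℝ)) ^ (d + 1)) ι k)))) (fun y y' => ind (g := unitTorusGeo L kk (cvM d L mv kk hL)) (cvSk d L mv kk hL k) y * ind (g := unitTorusGeo L kk (cvM d L mv kk hL)) (cvSk d L mv kk hL k) y' * ((C * εk) * Real.exp (-(δm * (unitTorusGeo L kk (cvM d L mv kk hL)).dist y y')))) := fun k μ => hasMaj_idef_cutB_scCube ι hM hm₁ hfitI hS0 hKc μ hDGB k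
  have hs2 : ∀ k, ∀ μ, mulOp (fun p : ScX d L mv kk hL × ι => (scChi d L mv kk hL k) p.1) ∘ₗ mulOp ((fun p : ScX d L mv kk hL × ι => (scBump d L mv kk hL k) p.1) ∘ (liftEquiv (scShift d L mv kk hL μ) ι)) = mulOp ((fun p : ScX d L mv kk hL × ι => (scBump d L mv kk hL k) p.1) ∘ (liftEquiv (scShift d L mv kk hL μ) ι)) := fun k μ => cut_bcube_comp_shift (2 * L) (fun ν (p : ScX d L mv kk hL × ι) => scXi d L mv kk hL ν p.1) 2 (fun μ => liftEquiv (scShift d L mv kk hL μ) ι) μ (hwin2 μ k)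
  have hsb2 : ∀ k, ∀ μ, mulOp (fun p : ScX d L mv kk hL × ι => (scChi d L mv kk hL k) p.1) ∘ₗ mulOp ((fun p : ScX d L mv kk hL × ι => (scBump d L mv kk hL k) p.1) ∘ (liftEquiv (scShift d L mv kk hL μ) ι).symm) = mulOp ((fun p : ScX d L mv kk hL × ι => (scBump d L mv kk hL k) p.1) ∘ (liftEquiv (scShift d L mv kk hL μ) ι).symm) := fun k μ => cut_bcube_comp_shift_symm (2 * L) (fun ν (p : ScX d L mv kk hL × ι) => scXi d L mv kk hL ν p.1) 2 (fun μ => liftEquiv (scShift d L mv kk hL μ) ι) μ (hwin2 μ k)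
  have hdd2 : ∀ k, ∀ μ, mulOp (fun p : ScX d L mv kk hL × ι => (scChi d L mv kk hL k) p.1) ∘ₗ mulOp (fgrad η⁻¹ (liftEquiv (scShift d L mv kk hL μ) ι) (fun p : ScX d L mv kk hL × ι => (scBump d L mv kk hL k) p.1)) = mulOp (fgrad η⁻¹ (liftEquiv (scShift d L mv kk hL μ) ι) (fun p : ScX d L mv kk hL × ι => (scBump d L mv kk hL k) p.1)) := fun k μ => cut_fgrad_bcube (2 * L) (fun ν (p : ScX d L mv kk hL × ι) => scXi d L mv kk hL ν p.1) 2 (fun μ => liftEquiv (scShift d L mv kk hL μ) ι) μ η⁻¹ (hwin2 μ k)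
  have hddb2 : ∀ k, ∀ μ, mulOp (fun p : ScX d L mv kk hL × ι => (scChi d L mv kk hL k) p.1) ∘ₗ mulOp (bgrad η⁻¹ (liftEquiv (scShift d L mv kk hL μ) ι) (fun p : ScX d L mv kk hL × ι => (scBump d L mv kk hL k) p.1)) = mulOp (bgrad η⁻¹ (liftEquiv (scShift d L mv kk hL μ) ι) (fun p : ScX d L mv kk hL × ι => (scBump d L mv kk hL k) p.1)) := fun k μ => cut_bgrad_bcube (2 * L) (fun ν (p : ScX d L mv kk hL × ι) => scXi d L mv kk hL ν p.1) 2 (fun μ => liftEquiv (scShift d L mv kk hL μ) ι) μ η⁻¹ (hwin2 μ k)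
  have hs2' : ∀ k, ∀ μ, mulOp (fun p' : ScX' d L mv kk r hL × ι => (scChi' d L mv kk r hL k) p'.1) ∘ₗ mulOp ((fun p' : ScX' d L mv kk r hL × ι => (scBump' d L mv kk r hL k) p'.1) ∘ (liftEquiv (scShift' d L mv kk r hL μ) ι)) = mulOp ((fun p' : ScX' d L mv kk r hL × ι => (scBump' d L mv kk r hL k) p'.1) ∘ (liftEquiv (scShift' d L mv kk r hL μ) ι)) := fun k μ => cut_bcube_comp_shift (2 * L) (fun ν (p : ScX' d L mv kk r hL × ι) => scXi' d L mv kk r hL ν p.1) 2 (fun μ => liftEquiv (scShift' d L mv kk r hL μ) ι) μ (hwin2' μ k)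
  have hsb2' : ∀ k, ∀ μ, mulOp (fun p' : ScX' d L mv kk r hL × ι => (scChi' d L mv kk r hL k) p'.1) ∘ₗ mulOp ((fun p' : ScX' d L mv kk r hL × ι => (scBump' d L mv kk r hL k) p'.1) ∘ (liftEquiv (scShift' d L mv kk r hL μ) ι).symm) = mulOp ((fun p' : ScX' d L mv kk r hL × ι => (scBump' d L mv kk r hL k) p'.1) ∘ (liftEquiv (scShift' d L mv kk r hL μ) ι).symm) := fun k μ => cut_bcube_comp_shift_symm (2 * L) (fun ν (p : ScX' d L mv kk r hL × ι) => scXi' d L mv kk r hL ν p.1) 2 (fun μ => liftEquiv (scShift' d L mv kk r hL μ) ι) μ (hwin2' μ k)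
  have hdd2' : ∀ k, ∀ μ, mulOp (fun p' : ScX' d L mv kk r hL × ι => (scChi' d L mv kk r hL k) p'.1) ∘ₗ mulOp (fgrad η'⁻¹ (liftEquiv (scShift' d L mv kk r hL μ) ι) (fun p' : ScX' d L mv kk r hL × ι => (scBump' d L mv kk r hL k) p'.1)) = mulOp (fgrad η'⁻¹ (liftEquiv (scShift' d L mv kk r hL μ) ι) (fun p' : ScX' d L mv kk r hL × ι => (scBump' d L mv kk r hL k) p'.1)) := fun k μ => cut_fgrad_bcube (2 * L) (fun ν (p : ScX' d L mv kk r hL × ι) => scXi' d L mv kk r hL ν p.1) 2 (fun μ => liftEquiv (scShift' d L mv kk r hL μ) ι) μ η'⁻¹ (hwin2' μ k)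
  have hddb2' : ∀ k, ∀ μ, mulOp (fun p' : ScX' d L mv kk r hL × ι => (scChi' d L mv kk r hL k) p'.1) ∘ₗ mulOp (bgrad η'⁻¹ (liftEquiv (scShift' d L mv kk r hL μ) ι) (fun p' : ScX' d L mv kk r hL × ι => (scBump' d L mv kk r hL k) p'.1)) = mulOp (bgrad η'⁻¹ (liftEquiv (scShift' d L mv kk r hL μ) ι) (fun p' : ScX' d L mv kk r hL × ι => (scBump' d L mv kk r hL k) p'.1)) := fun k μ => cut_bgrad_bcube (2 * L) (fun ν (p : ScX' d L mv kk r hL × ι) => scXi' d L mv kk r hL ν p.1) 2 (fun μ => liftEquiv (scShift' d L mv kk r hL μ) ι) μ η'⁻¹ (hwin2' μ k)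
  have hh1 : ∀ k, ∀ μ p, |fgrad η⁻¹ (liftEquiv (scShift d L mv kk hL μ) ι) (fun p : ScX d L mv kk hL × ι => scH d L mv kk hL k p.1) p| ≤ (π / W) := by rw [hηinv]; exact fun k μ p => (abs_fgrad_hcube_le (2 * L) (fun ν (p : ScX d L mv kk hL × ι) => scXi d L mv kk hL ν p.1) (fun μ => liftEquiv (scShift d L mv kk hL μ) ι) hK0 hξS _ k μ p).trans hsW.le
  have hh1b : ∀ k, ∀ μ p, |bgrad η⁻¹ (liftEquiv (scShift d L mv kk hL μ) ι) (fun p : ScX d L mv kk hL × ι => scH d L mv kk hL k p.1) p| ≤ (π / W) := by rw [hηinv]; exact fun k μ p => (abs_bgrad_hcube_le (2 * L) (fun ν (p : ScX d L mv kk hL × ι) => scXi d L mv kk hL ν p.1) (fun μ => liftEquiv (scShift d L mv kk hL μ) ι) hK0 hξS _ k μ p).trans hsW.le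
  have hh1' : ∀ k, ∀ μ p', |fgrad η'⁻¹ (liftEquiv (scShift' d L mv kk r hL μ) ι) (fun p : ScX' d L mv kk r hL × ι => scH' d L mv kk r hL k p.1) p'| ≤ (π / W) := by rw [hη'inv]; exact fun k μ p => (abs_fgrad_hcube_le (2 * L) (fun ν (p : ScX' d L mv kk r hL × ι) => scXi' d L mv kk r hL ν p.1) (fun μ => liftEquiv (scShift' d L mv kk r hL μ) ι) hK0 hξS' _ k μ p).trans hsW'.le
  have hh1b' : ∀ k, ∀ μ p', |bgrad η'⁻¹ (liftEquiv (scShift' d L mv kk r hL μ) ι) (fun p : ScX' d L mv kk r hL × ι => scH' d L mv kk r hL k p.1) p'| ≤ (π / W) := by rw [hη'inv]; exact fun k μ p => (abs_bgrad_hcube_le (2 * L) (fun ν (p : ScX' d L mv kk r hL × ι) => scXi' d L mv kk r hL ν p.1) (fun μ => liftEquiv (scShift' d L mv kk r hL μ) ι) hK0 hξS' _ k μ p).trans hsW'.le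
  have hh2' : ∀ k, ∀ μ p', |fgradAdj η'⁻¹ (liftEquiv (scShift' d L mv kk r hL μ) ι) (fgrad η'⁻¹ (liftEquiv (scShift' d L mv kk r hL μ) ι) (fun p : ScX' d L mv kk r hL × ι => scH' d L mv kk r hL k p.1)) p'| ≤ (32 * π ^ 2 / W ^ 2) := by rw [hη'inv]; exact fun k μ p => (abs_fgradAdj_fgrad_hcube_le (2 * L) (fun ν (p : ScX' d L mv kk r hL × ι) => scXi' d L mv kk r hL ν p.1) (fun μ => liftEquiv (scShift' d L mv kk r hL μ) ι) hK2 hξS' hs0f hs1f _ k μ p).trans hsW2'.le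
  have hf1 : ∀ k, ∀ μ p', |fgrad η'⁻¹ (liftEquiv (scShift' d L mv kk r hL μ) ι) (fun p : ScX' d L mv kk r hL × ι => scH' d L mv kk r hL k p.1) p' - fgrad η⁻¹ (liftEquiv (scShift d L mv kk hL μ) ι) (fun p : ScX d L mv kk hL × ι => scH d L mv kk hL k p.1) (liftMap (kingPr L kk r (cvM d L mv kk hL)) ι p')| ≤ O1 := by rw [hηinv, hη'inv]; exact fun k μ p' => abs_fgrad_scH'_sub_le ι hM hw h3 k μ p'
  have hf1b : ∀ k, ∀ μ p', |bgrad η'⁻¹ (liftEquiv (scShift' d L mv kk r hL μ) ι) (fun p : ScX' d L mv kk r hL × ι => scH' d L mv kk r hL k p.1) p' - bgrad η⁻¹ (liftEquiv (scShift d L mv kk hL μ) ι) (fun p : ScX d L mv kk hL × ι => scH d L mv kk hL k p.1) (liftMap (kingPr L kk r (cvM d L mv kk hL)) ι p')| ≤ O1 := by rw [hηinv, hη'inv]; exact fun k μ p' => abs_bgrad_scH'_sub_le ι hM hw h3 k μ p'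
  have hf2 : ∀ k, ∀ μ p', |fgradAdj η'⁻¹ (liftEquiv (scShift' d L mv kk r hL μ) ι) (fgrad η'⁻¹ (liftEquiv (scShift' d L mv kk r hL μ) ι) (fun p : ScX' d L mv kk r hL × ι => scH' d L mv kk r hL k p.1)) p' - fgradAdj η⁻¹ (liftEquiv (scShift d L mv kk hL μ) ι) (fgrad η⁻¹ (liftEquiv (scShift d L mv kk hL μ) ι) (fun p : ScX d L mv kk hL × ι => scH d L mv kk hL k p.1)) (liftMap (kingPr L kk r (cvM d L mv kk hL)) ι p')| ≤ O2 := by rw [hηinv, hη'inv]; exact fun k μ p' => abs_fgradAdj_fgrad_scH'_sub_le ι hM hw h3 k μ p'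
  have hLip : ∀ k, ∀ y y', |(coverHb (cvM d L mv kk hL) (L ^ kk) (L ^ mv) L k) y - (coverHb (cvM d L mv kk hL) (L ^ kk) (L ^ mv) L k) y'| ≤ (π * (d + 1) / W) * (unitTorusGeo L kk (cvM d L mv kk hL)).dist y y' := fun k y y' => abs_coverHb_sub_le hM hw k y y'; have hrh : ∀ k (p : ScX d L mv kk hL × ι), |scH d L mv kk hL k p.1 - (coverHb (cvM d L mv kk hL) (L ^ kk) (L ^ mv) L k) (liftBlk (scBlk d L mv kk hL) ι p)| ≤ (π * (d + 1) / W) := fun k p => abs_coverH_sub_coverHb_le hM hw k (p.1, 0)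
  have hrh' : ∀ k (p' : ScX' d L mv kk r hL × ι), |scH' d L mv kk r hL k p'.1 - (coverHb (cvM d L mv kk hL) (L ^ kk) (L ^ mv) L k) (liftBlk (scBlk d L mv kk hL ∘ (kingPr L kk r (cvM d L mv kk hL))) ι p')| ≤ (π * (d + 1) / W) := fun k p' => abs_scH'_sub_coverHb_kingPr_le ι hM hw k p'; have hfh : ∀ k (p' : ScX' d L mv kk r hL × ι), |scH' d L mv kk r hL k p'.1 - scH d L mv kk hL k ((kingPr L kk r (cvM d L mv kk hL)) p'.1)| ≤ (π * (d + 1) / (((L ^ kk : ℕ) : ℝ) * W)) := fun k p' => abs_scH'_sub_scH_kingPr_le ι hM hw k p'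
  have hKN' : ∀ k, HasMaj (BlockNorm.ofBlocks (unitTorusGeo L kk (cvM d L mv kk hL)) (liftBlk (scBlk d L mv kk hL ∘ kingPr L kk r (cvM d L mv kk hL)) ι)) (BlockNorm.ofBlocks (unitTorusGeo L kk (cvM d L mv kk hL)) (liftBlk (scBlk d L mv kk hL ∘ kingPr L kk r (cvM d L mv kk hL)) ι)) (commOp (scQQ' d L mv kk r hL (aK a₀ (L : ℝ) (r + kk) * (((L ^ r * L ^ kk : ℕ) : ℝ)) ^ (d + 1)) ι) (fun p : ScX' d L mv kk r hL × ι => scH' d L mv kk r hL k p.1)) (fun y y' => ((π * (d + 1) / W * 0 + 2 * (π * (d + 1) / W)) * a₀) * Real.exp (-((δm - δm / 2) * (unitTorusGeo L kk (cvM d L mv kk hL)).dist y y'))) := fun k => hasMaj_src_tgt_congr hblk' ((hasMaj_commOp_scQQ' ι hM hw _ (δm - δm / 2) k).mono fun y y' => mul_le_mul_of_nonneg_right hcNle' (Real.exp_nonneg _))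
  have hDKN : ∀ k, HasMaj (ScNorm d L mv kk hL ι) (BlockNorm.ofBlocks (unitTorusGeo L kk (cvM d L mv kk hL)) (liftBlk (scBlk d L mv kk hL ∘ kingPr L kk r (cvM d L mv kk hL)) ι)) (idef (pull (liftMap (kingPr L kk r (cvM d L mv kk hL)) ι)) (pull (liftMap (kingPr L kk r (cvM d L mv kk hL)) ι)) (commOp (scQQ' d L mv kk r hL (aK a₀ (L : ℝ) (r + kk) * (((L ^ r * L ^ kk : ℕ) : ℝ)) ^ (d + 1)) ι) (fun p : ScX' d L mv kk r hL × ι => scH' d L mv kk r hL k p.1)) (commOp (scQQ d L mv kk hL (aK a₀ (L : ℝ) kk * (((L ^ kk : ℕ) : ℝ)) ^ (d + 1)) ι) (fun p : ScX d L mv kk hL × ι => scH d L mv kk hL k p.1))) (fun y y' => RNK * Real.exp (-((δm - δm / 2) * (unitTorusGeo L kk (cvM d L mv kk hL)).dist y y'))) := fun k => hasMaj_idef_commOp_scQQ_scH_king ι hM hw hL2R hk ha₀ (γ := (1 / 4 : ℝ)) (by norm_num) k δm (ε := δm / 2) (by positivity)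
  have hh2 : ∀ k, ∀ μ p, |fgradAdj η⁻¹ (liftEquiv (scShift d L mv kk hL μ) ι) (fgrad η⁻¹ (liftEquiv (scShift d L mv kk hL μ) ι) (fun p : ScX d L mv kk hL × ι => scH d L mv kk hL k p.1)) p| ≤ (32 * π ^ 2 / W ^ 2) := by rw [hηinv]; exact fun k μ p => (abs_fgradAdj_fgrad_hcube_le (2 * L) (fun ν (p : ScX d L mv kk hL × ι) => scXi d L mv kk hL ν p.1) (fun μ => liftEquiv (scShift d L mv kk hL μ) ι) hK2 hξS hs0c hs1c _ k μ p).trans hsW2.le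
  have hKN : ∀ k, HasMaj (ScNorm d L mv kk hL ι) (ScNorm d L mv kk hL ι) (commOp (scQQ d L mv kk hL (aK a₀ (L : ℝ) kk * (((L ^ kk : ℕ) : ℝ)) ^ (d + 1)) ι) (fun p : ScX d L mv kk hL × ι => scH d L mv kk hL k p.1)) (fun y y' => ((π * (d + 1) / W * 0 + 2 * (π * (d + 1) / W)) * a₀) * Real.exp (-((δm - δm / 2) * (unitTorusGeo L kk (cvM d L mv kk hL)).dist y y'))) := fun k => (hasMaj_commOp_scQQ ι hM hw _ (δm - δm / 2) k).mono fun y y' => mul_le_mul_of_nonneg_right hcNle (Real.exp_nonneg _)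
  have hhcut : ∀ k, mulOp (fun p : ScX d L mv kk hL × ι => scH d L mv kk hL k p.1) ∘ₗ mulOp (fun p : ScX d L mv kk hL × ι => scChi d L mv kk hL k p.1) = mulOp (fun p : ScX d L mv kk hL × ι => scH d L mv kk hL k p.1) := fun k => hcube_cut (2 * L) (fun ν (p : ScX d L mv kk hL × ι) => scXi d L mv kk hL ν p.1) (fun μ => liftEquiv (scShift d L mv kk hL μ) ι) 0 (hwin 0 k)
  have hhcut' : ∀ k, mulOp (fun p : ScX' d L mv kk r hL × ι => scH' d L mv kk r hL k p.1) ∘ₗ mulOp (fun p : ScX' d L mv kk r hL × ι => scChi' d L mv kk r hL k p.1) = mulOp (fun p : ScX' d L mv kk r hL × ι => scH' d L mv kk r hL k p.1) := fun k => hcube_cut (2 * L) (fun ν (p : ScX' d L mv kk r hL × ι) => scXi' d L mv kk r hL ν p.1) (fun μ => liftEquiv (scShift' d L mv kk r hL μ) ι) 0 (hwin' 0 k)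
  have hN : ∀ b, ∑ k, ind (g := unitTorusGeo L kk (cvM d L mv kk hL)) (cvSk d L mv kk hL k) b ≤ Nov := fun y => sum_ind_cubeBlocks_le (M := cvM d L mv kk hL) (w := L ^ mv) (q := L) (m₀ := coverMargin L mv) L kk y
  have hT : ∀ k, HasMaj (ScNorm d L mv kk hL ι) (ScNorm d L mv kk hL ι) ((-(mulOp (fun p : ScX d L mv kk hL × ι => scH d L mv kk hL k p.1) ∘ₗ (scQQ d L mv kk hL (aK a₀ (L : ℝ) kk * (((L ^ kk : ℕ) : ℝ)) ^ (d + 1)) ι) ∘ₗ mulOp (1 - fun p : ScX d L mv kk hL × ι => scBump d L mv kk hL k p.1))) ∘ₗ (scCube d L mv kk hL (aK a₀ (L : ℝ) kk * (((L ^ kk : ℕ) : ℝ)) ^ (d + 1)) ι k)) (fun y y' => ind (g := unitTorusGeo L kk (cvM d L mv kk hL)) (cvSk d L mv kk hL k) y * ind (g := unitTorusGeo L kk (cvM d L mv kk hL)) (cvSk d L mv kk hL k) y' * ((0:ℝ) * Real.exp (-((δm / 2) * (unitTorusGeo L kk (cvM d L mv kk hL)).dist y y')))) := fun k => by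
    rw [mulOp_scH_comp_scQQ_comp_one_sub_scBump ι hw _ k, neg_zero, LinearMap.zero_comp]
    exact (hasMaj_zero _ _).mono fun y y' => mul_nonneg (mul_nonneg (ind_nonneg _ _) (ind_nonneg _ _)) (by positivity)
  have hT' : ∀ k, HasMaj (BlockNorm.ofBlocks (unitTorusGeo L kk (cvM d L mv kk hL)) (liftBlk (scBlk d L mv kk hL ∘ kingPr L kk r (cvM d L mv kk hL)) ι)) (BlockNorm.ofBlocks (unitTorusGeo L kk (cvM d L mv kk hL)) (liftBlk (scBlk d L mv kk hL ∘ kingPr L kk r (cvM d L mv kk hL)) ι)) ((-(mulOp (fun p : ScX' d L mv kk r hL × ι => scH' d L mv kk r hL k p.1) ∘ₗ (scQQ' d L mv kk r hL (aK a₀ (L : ℝ) (r + kk) * (((L ^ r * L ^ kk : ℕ) : ℝ)) ^ (d + 1)) ι) ∘ₗ mulOp (1 - fun p : ScX' d L mv kk r hL × ι => scBump' d L mv kk r hL k p.1))) ∘ₗ (scCube' d L mv kk r hL (aK a₀ (L : ℝ) (r + kk) * (((L ^ r * L ^ kk : ℕ) : ℝ)) ^ (d + 1)) ι k)) (fun y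 y' => ind (g := unitTorusGeo L kk (cvM d L mv kk hL)) (cvSk d L mv kk hL k) y * ind (g := unitTorusGeo L kk (cvM d L mv kk hL)) (cvSk d L mv kk hL k) y' * ((0:ℝ) * Real.exp (-((δm / 2) * (unitTorusGeo L kk (cvM d L mv kk hL)).dist y y')))) := fun k => by
    rw [mulOp_scH'_comp_scQQ'_comp_one_sub_scBump' ι hw _ k, neg_zero, LinearMap.zero_comp]
    exact (hasMaj_zero _ _).mono fun y y' => mul_nonneg (mul_nonneg (ind_nonneg _ _) (ind_nonneg _ _)) (by positivity)
  have hDT : ∀ k, HasMaj (ScNorm d L mv kk hL ι) (BlockNorm.ofBlocks (unitTorusGeo L kk (cvM d L mv kk hL)) (liftBlk (scBlk d L mv kk hL ∘ kingPr L kk r (cvM d L mv kk hL)) ι)) (idef (pull (liftMap (kingPr L kk r (cvM d L mv kk hL)) ι)) (pull (liftMap (kingPr L kk r (cvM d L mv kk hL)) ι)) ((-(mulOp (fun p : ScX' d L mv kk r hL × ι => scH' d L mv kk r hL k p.1) ∘ₗ (scQQ' d L mv kk r hL (aK a₀ (L : ℝ) (r + kk) * (((L ^ r * L ^ kk : ℕ)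 : ℝ)) ^ (d + 1)) ι) ∘ₗ mulOp (1 - fun p : ScX' d L mv kk r hL × ι => scBump' d L mv kk r hL k p.1))) ∘ₗ (scCube' d L mv kk r hL (aK a₀ (L : ℝ) (r + kk) * (((L ^ r * L ^ kk : ℕ) : ℝ)) ^ (d + 1)) ι k)) ((-(mulOp (fun p : ScX d L mv kk hL × ι => scH d L mv kk hL k p.1) ∘ₗ (scQQ d L mv kk hL (aK a₀ (L : ℝ) kk * (((L ^ kk : ℕ) : ℝ)) ^ (d + 1)) ι) ∘ₗ mulOp (1 - fun p : ScX d L mv kk hL × ι => scBump d L mv kk hL k p.1))) ∘ₗ (scCube d L mv kk hL (aK a₀ (L : ℝ) kk * (((L ^ kk : ℕ) : ℝ)) ^ (d + 1)) ι k))) (fun y y' => ind (g := unitTorusGeo L kk (cvM d L mv kk hL)) (cvSk d L mv kk hL k) y * ind (g := unitTorusGeo L kk (cvM d L mv kk hL)) (cvSk d L mv kk hL k) y' * ((0:ℝ) * Real.exp (-((δm / 2) * (unitTorusGeo L kk (cvM d L mv kk hL)).dist y y')))) := fun k => hasMaj_idef_tail_scCube ι hw _ _ le_rfl _ k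
  have hψχ : ∀ k, mulOp (fun p : ScX d L mv kk hL × ι => scPsi d L mv kk hL k p.1) ∘ₗ mulOp (fun p : ScX d L mv kk hL × ι => scChi d L mv kk hL k p.1) = mulOp (fun p : ScX d L mv kk hL × ι => scChi d L mv kk hL k p.1) := fun k => mulOp_comp_mulOp_of_support_left fun p hp => chiCube_eq_one_of_inner_ne_zero hM hm₁ hfitI hS0 hp
  have hψχ' : ∀ k, mulOp (fun p : ScX' d L mv kk r hL × ι => scPsi' d L mv kk r hL k p.1) ∘ₗ mulOp (fun p : ScX' d L mv kk r hL × ι => scChi' d L mv kk r hL k p.1) = mulOp (fun p : ScX' d L mv kk r hL × ι => scChi' d L mv kk r hL k p.1) := fun k => mulOp_comp_mulOp_of_support_left fun p hp => chiCube_eq_one_of_inner_ne_zero hM hm₁ hfitI hS0 hp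
  have hNVcut' : ∀ k, HasMaj (BlockNorm.ofBlocks (unitTorusGeo L kk (cvM d L mv kk hL)) (liftBlk (scBlk d L mv kk hL ∘ kingPr L kk r (cvM d L mv kk hL)) ι)) (BlockNorm.ofBlocks (unitTorusGeo L kk (cvM d L mv kk hL)) (liftBlk (scBlk d L mv kk hL ∘ kingPr L kk r (cvM d L mv kk hL)) ι)) (mulOp (fun p : ScX' d L mv kk r hL × ι => scPsi' d L mv kk r hL k p.1) ∘ₗ NV' k ∘ₗ mulOp (fun p : ScX' d L mv kk r hL × ι => scChi' d L mv kk r hL k p.1)) (fun y y' => RN * Real.exp (-(δm * (unitTorusGeo L kk (cvM d L mv kk hL)).dist y y'))) := fun k => hasMaj_src_tgt_congr hblk' (hNVcut' k)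
  have hfarN : ∀ k, HasMaj (ScNorm d L mv kk hL ι) (ScNorm d L mv kk hL ι) ((LinearMap.id - mulOp (fun p : ScX d L mv kk hL × ι => scPsi d L mv kk hL k p.1)) ∘ₗ NV k ∘ₗ mulOp (fun p : ScX d L mv kk hL × ι => scChi d L mv kk hL k p.1)) (fun y y' => θ₀ * Real.exp (-(δm * (unitTorusGeo L kk (cvM d L mv kk hL)).dist y y'))) := fun k => (hfarN k).mono fun y y' => mul_le_mul_of_nonneg_right hθle (Real.exp_nonneg _)
  have hfarN' : ∀ k, HasMaj (BlockNorm.ofBlocks (unitTorusGeo L kk (cvM d L mv kk hL)) (liftBlk (scBlk d L mv kk hL ∘ kingPr L kk r (cvM d L mv kk hL)) ι)) (BlockNorm.ofBlocks (unitTorusGeo L kk (cvM d L mv kk hL)) (liftBlk (scBlk d L mv kk hL ∘ kingPr L kk r (cvM d L mv kk hL)) ι)) ((LinearMap.id - mulOp (fun p : ScX' d L mv kk r hL × ι => scPsi' d L mv kk r hL k p.1)) ∘ₗ NV' k ∘ₗ mulOp (fun p : ScX' d L mv kk r hL × ι => scChi' d L mv kk r hL k p.1)) (fun y y' => θ₀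 * Real.exp (-(δm * (unitTorusGeo L kk (cvM d L mv kk hL)).dist y y'))) := fun k => hasMaj_src_tgt_congr hblk' ((hfarN' k).mono fun y y' => mul_le_mul_of_nonneg_right hθle (Real.exp_nonneg _))
  have hhψ : ∀ k, mulOp (fun p : ScX d L mv kk hL × ι => scH d L mv kk hL k p.1) ∘ₗ mulOp (fun p : ScX d L mv kk hL × ι => scPsi d L mv kk hL k p.1) = mulOp (fun p : ScX d L mv kk hL × ι => scH d L mv kk hL k p.1) := fun k => mulOp_scH_comp_mulOp_scPsi ι hM hw hfit k
  have hχh : ∀ k, mulOp (fun p : ScX d L mv kk hL × ι => scChi d L mv kk hL k p.1) ∘ₗ mulOp (fun p : ScX d L mv kk hL × ι => scH d L mv kk hL k p.1) = mulOp (fun p : ScX d L mv kk hL × ι => scH d L mv kk hL k p.1) := fun k => cut_hcube (2 * L) (fun ν (p : ScX d L mv kk hL × ι) => scXi d L mv kk hL ν p.1) 2 (fun μ => liftEquiv (scShift d L mv kk hL μ) ι) 0 (by norm_num) (hwin2 0 k)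
  have hhs' : ∀ k μ, mulOp (fun p : ScX d L mv kk hL × ι => scChi d L mv kk hL k p.1) ∘ₗ mulOp ((fun p : ScX d L mv kk hL × ι => scH d L mv kk hL k p.1) ∘ (liftEquiv (scShift d L mv kk hL μ) ι)) = mulOp ((fun p : ScX d L mv kk hL × ι => scH d L mv kk hL k p.1) ∘ (liftEquiv (scShift d L mv kk hL μ) ι)) := fun k μ => cut_hcube_comp_shift (2 * L) (fun ν (p : ScX d L mv kk hL × ι) => scXi d L mv kk hL ν p.1) 2 (fun μ => liftEquiv (scShift d L mv kk hL μ) ι) μ (by norm_num) (hwin2 μ k)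
  have hhsb' : ∀ k μ, mulOp (fun p : ScX d L mv kk hL × ι => scChi d L mv kk hL k p.1) ∘ₗ mulOp ((fun p : ScX d L mv kk hL × ι => scH d L mv kk hL k p.1) ∘ (liftEquiv (scShift d L mv kk hL μ) ι).symm) = mulOp ((fun p : ScX d L mv kk hL × ι => scH d L mv kk hL k p.1) ∘ (liftEquiv (scShift d L mv kk hL μ) ι).symm) := fun k μ => cut_hcube_comp_shift_symm (2 * L) (fun ν (p : ScX d L mv kk hL × ι) => scXi d L mv kk hL ν p.1) 2 (fun μ => liftEquiv (scShift d L mv kk hL μ) ι) μ (by norm_num) (hwin2 μ k)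
  have hhdd' : ∀ k μ, mulOp (fun p : ScX d L mv kk hL × ι => scChi d L mv kk hL k p.1) ∘ₗ mulOp (fgrad η⁻¹ (liftEquiv (scShift d L mv kk hL μ) ι) (fun p : ScX d L mv kk hL × ι => scH d L mv kk hL k p.1)) = mulOp (fgrad η⁻¹ (liftEquiv (scShift d L mv kk hL μ) ι) (fun p : ScX d L mv kk hL × ι => scH d L mv kk hL k p.1)) := fun k μ => cut_fgrad_hcube (2 * L) (fun ν (p : ScX d L mv kk hL × ι) => scXi d L mv kk hL ν p.1) 2 (fun μ => liftEquiv (scShift d L mv kk hL μ) ι) μ (by norm_num) η⁻¹ (hwin2 μ k)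
  have hhddb' : ∀ k μ, mulOp (fun p : ScX d L mv kk hL × ι => scChi d L mv kk hL k p.1) ∘ₗ mulOp (bgrad η⁻¹ (liftEquiv (scShift d L mv kk hL μ) ι) (fun p : ScX d L mv kk hL × ι => scH d L mv kk hL k p.1)) = mulOp (bgrad η⁻¹ (liftEquiv (scShift d L mv kk hL μ) ι) (fun p : ScX d L mv kk hL × ι => scH d L mv kk hL k p.1)) := fun k μ => cut_bgrad_hcube (2 * L) (fun ν (p : ScX d L mv kk hL × ι) => scXi d L mv kk hL ν p.1) 2 (fun μ => liftEquiv (scShift d L mv kk hL μ) ι) μ (by norm_num) η⁻¹ (hwin2 μ k)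
  have hhψf : ∀ k, mulOp (fun p : ScX' d L mv kk r hL × ι => scH' d L mv kk r hL k p.1) ∘ₗ mulOp (fun p : ScX' d L mv kk r hL × ι => scPsi' d L mv kk r hL k p.1) = mulOp (fun p : ScX' d L mv kk r hL × ι => scH' d L mv kk r hL k p.1) := fun k => mulOp_scH'_comp_mulOp_scPsi' ι hM hw hfit k
  have hχhf : ∀ k, mulOp (fun p : ScX' d L mv kk r hL × ι => scChi' d L mv kk r hL k p.1) ∘ₗ mulOp (fun p : ScX' d L mv kk r hL × ι => scH' d L mv kk r hL k p.1) = mulOp (fun p : ScX' d L mv kk r hL × ι => scH' d L mv kk r hL k p.1) := fun k => cut_hcube (2 * L) (fun ν (p : ScX' d L mv kk r hL × ι) => scXi' d L mv kk r hL ν p.1) 2 (fun μ => liftEquiv (scShift' d L mv kk r hL μ) ι) 0 (by norm_num) (hwin2' 0 k)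
  have hhsf : ∀ k μ, mulOp (fun p : ScX' d L mv kk r hL × ι => scChi' d L mv kk r hL k p.1) ∘ₗ mulOp ((fun p : ScX' d L mv kk r hL × ι => scH' d L mv kk r hL k p.1) ∘ (liftEquiv (scShift' d L mv kk r hL μ) ι)) = mulOp ((fun p : ScX' d L mv kk r hL × ι => scH' d L mv kk r hL k p.1) ∘ (liftEquiv (scShift' d L mv kk r hL μ) ι)) := fun k μ => cut_hcube_comp_shift (2 * L) (fun ν (p : ScX' d L mv kk r hL × ι) => scXi' d L mv kk r hL ν p.1) 2 (fun μ => liftEquiv (scShift' d L mv kk r hL μ) ι) μ (by norm_num) (hwin2' μ k)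
  have hhsbf : ∀ k μ, mulOp (fun p : ScX' d L mv kk r hL × ι => scChi' d L mv kk r hL k p.1) ∘ₗ mulOp ((fun p : ScX' d L mv kk r hL × ι => scH' d L mv kk r hL k p.1) ∘ (liftEquiv (scShift' d L mv kk r hL μ) ι).symm) = mulOp ((fun p : ScX' d L mv kk r hL × ι => scH' d L mv kk r hL k p.1) ∘ (liftEquiv (scShift' d L mv kk r hL μ) ι).symm) := fun k μ => cut_hcube_comp_shift_symm (2 * L) (fun ν (p : ScX' d L mv kk r hL × ι) => scXi' d L mv kk r hL ν p.1) 2 (fun μ => liftEquiv (scShift' d L mv kk r hL μ) ι) μ (by norm_num) (hwin2' μ k)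
  have hhddf : ∀ k μ, mulOp (fun p : ScX' d L mv kk r hL × ι => scChi' d L mv kk r hL k p.1) ∘ₗ mulOp (fgrad η'⁻¹ (liftEquiv (scShift' d L mv kk r hL μ) ι) (fun p : ScX' d L mv kk r hL × ι => scH' d L mv kk r hL k p.1)) = mulOp (fgrad η'⁻¹ (liftEquiv (scShift' d L mv kk r hL μ) ι) (fun p : ScX' d L mv kk r hL × ι => scH' d L mv kk r hL k p.1)) := fun k μ => cut_fgrad_hcube (2 * L) (fun ν (p : ScX' d L mv kk r hL × ι) => scXi' d L mv kk r hL ν p.1) 2 (fun μ => liftEquiv (scShift' d L mv kk r hL μ) ι) μ (by norm_num) η'⁻¹ (hwin2' μ k)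
  have hhddbf : ∀ k μ, mulOp (fun p : ScX' d L mv kk r hL × ι => scChi' d L mv kk r hL k p.1) ∘ₗ mulOp (bgrad η'⁻¹ (liftEquiv (scShift' d L mv kk r hL μ) ι) (fun p : ScX' d L mv kk r hL × ι => scH' d L mv kk r hL k p.1)) = mulOp (bgrad η'⁻¹ (liftEquiv (scShift' d L mv kk r hL μ) ι) (fun p : ScX' d L mv kk r hL × ι => scH' d L mv kk r hL k p.1)) := fun k μ => cut_bgrad_hcube (2 * L) (fun ν (p : ScX' d L mv kk r hL × ι) => scXi' d L mv kk r hL ν p.1) 2 (fun μ => liftEquiv (scShift' d L mv kk r hL μ) ι) μ (by norm_num) η'⁻¹ (hwin2' μ k)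
  have hTk : ∀ k, (ctauS (cvM d L mv kk hL) L kk r (fun μ x' => coordMat e (ContinuousLinearMap.mulLeftRight ℝ (Matrix mm mm ℂ) (U' μ x') (U' μ x')ᴴ))) = mmulOp (fun x' => (coordMat e (ContinuousLinearMap.mulLeftRight ℝ (Matrix mm mm ℂ) (u' k x') (u' k x')ᴴ))ᵀ) ∘ₗ (mmulOp (fun x' => (kingStairT (cvM d L mv kk hL) (L ^ r * L ^ kk) (L ^ r) (fun μ b => coordMat e (ContinuousLinearMap.mulLeftRight ℝ (Matrix mm mm ℂ) (u' k b.1 * U' μ b.1 * (u' k (b.1 + unitVec (fine (L ^ r * L ^ kk) (cvM d L mv kk hL)) μ))ᴴ) (u' k b.1 * U' μ b.1 * (u' k (b.1 + unitVec (fine (L ^ r * L ^ kk) (cvM d L mv kk hL)) μ))ᴴ)ᴴ)) (x', 0))ᵀ) ∘ₗ pull (liftMap (kingPr L kk r (cvM d L mv kk hL)) ι)) ∘ₗ mmulOp (fun x => coordMat e (ContinuousLinearMap.mulLeftRight ℝ (Matrix mm mm ℂ) (u' k (kingSec (cvM d L mv kk hL) L kk r x)) (u' k (kingSec (cvM d L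 mv kk hL) L kk r x))ᴴ)) := fun k => ctauS_coordMat_Ad_eq_conj (cvM d L mv kk hL) L kk r e he (hu' k) U'
  have hΨ : ∀ x' i j, |(kingStairT (cvM d L mv kk hL) (L ^ r * L ^ kk) (L ^ r) (fun μ b => coordMat e (ContinuousLinearMap.mulLeftRight ℝ (Matrix mm mm ℂ) (U' μ b.1) (U' μ b.1)ᴴ)) (x', 0))ᵀ i j| ≤ 1 := fun x' i j => abs_kingStairT_coordMat_Ad_transpose_le_one (cvM d L mv kk hL) L kk r e he hU' (x', 0) i j
  have hψoh : ∀ k, mulOp (fun p : ScX d L mv kk hL × ι => scPsi d L mv kk hL k p.1) ∘ₗ mulOp (fun p : ScX d L mv kk hL × ι => scH d L mv kk hL k p.1) = mulOp (fun p : ScX d L mv kk hL × ι => scH d L mv kk hL k p.1) := fun k => by rw [mulOp_comp_mulOp_comm]; exact mulOp_scH_comp_mulOp_scPsi ι hM hw hfit k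
  have hKout : ∀ k, mulOp (fun p : ScX d L mv kk hL × ι => scPsi d L mv kk hL k p.1) ∘ₗ (commOp (mmulOp (fun x => coordMat e (ContinuousLinearMap.mulLeftRight ℝ (Matrix mm mm ℂ) (u' k (kingSec (cvM d L mv kk hL) L kk r x)) (u' k (kingSec (cvM d L mv kk hL) L kk r x))ᴴ)) ∘ₗ (covLapM (scShift d L mv kk hL) η (gaugePair (scShift d L mv kk hL) (fun μ x => coordMat e (ContinuousLinearMap.mulLeftRight ℝ (Matrix mm mm ℂ) (U μ x) (U μ x)ᴴ))) + P) ∘ₗ mmulOp (fun x => (coordMat e (ContinuousLinearMap.mulLeftRight ℝ (Matrix mm mm ℂ) (u' k (kingSec (cvM d L mv kk hL) L kk r x)) (u' k (kingSec (cvM d L mv kk hL) L kk r x))ᴴ))ᵀ)) (fun p : ScX d L mv kk hL × ι => scH d L mv kk hL k p.1) ∘ₗ (projO none ∘ₗ bgPropV (stack (mulOp (fun p : ScX d L mv kk hL × ι => scBump d L mv kk hL k p.1) ∘ₗ (scCube d L mv kk hL (aK a₀ (L : ℝ) kk * (((L ^ kk : ℕ) : ℝ)) ^ (d + 1)) ι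 k)) (fun j => Sum.elim (fun μ => fgrad η⁻¹ (liftEquiv
      (scShift d L mv kk hL μ) ι)) (fun μ => bgrad η⁻¹ (liftEquiv (scShift d L mv kk hL μ) ι)) j ∘ₗ (mulOp (fun p : ScX d L mv kk hL × ι => scBump d L mv kk hL k p.1) ∘ₗ (scCube d L mv kk hL (aK a₀ (L : ℝ) kk * (((L ^ kk : ℕ) : ℝ)) ^ (d + 1)) ι k)))) (mulOp (fun p : ScX d L mv kk hL × ι => scPsi d L mv kk hL k p.1) ∘ₗ (unstackM (tCoefC η (gaugePair (scShift d L mv kk hL) fun μ x => coordMat e (ContinuousLinearMap.mulLeftRight ℝ (Matrix mm mm ℂ) (u' k (kingSec (cvM d L mv kk hL) L kk r x) * U μ x * (u' k (kingSec (cvM d L mv kk hL) L kk r (scShift d L mv kk hL μ x)))ᴴ) (u' k (kingSec (cvM d L mv kk hL) L kk r x) * U μ x * (u' k (kingSec (cvM d L mv kk hL) L kk r (scShift d L mv kk hL μ x)))ᴴ)ᴴ))) (tCoefA η (gaugePair (scShift d L mv kk hL) fun μ x => coordMat e (ContinuousLinearMap.mulLeftRight ℝ (Matrix mm mm ℂ)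 (u' k (kingSec (cvM d L mv kk hL) L kk r x) * U μ x * (u' k (kingSec (cvM d
      L mv kk hL) L kk r (scShift d L mv kk hL μ x)))ᴴ) (u' k (kingSec (cvM d L mv kk hL) L kk r x) * U μ x * (u' k (kingSec (cvM d L mv kk hL) L kk r (scShift d L mv kk hL μ x)))ᴴ)ᴴ))) + NV k ∘ₗ projO none) ∘ₗ mulOp (fun q : (ScX d L mv kk hL × ι) × Option (Fin (d + 1) ⊕ Fin (d + 1)) => scChi d L mv kk hL k q.1.1)))) = commOp (mmulOp (fun x => coordMat e (ContinuousLinearMap.mulLeftRight ℝ (Matrix mm mm ℂ) (u' k (kingSec (cvM d L mv kk hL) L kk r x)) (u' k (kingSec (cvM d L mv kk hL) L kk r x))ᴴ)) ∘ₗ (covLapM (scShift d L mv kk hL) η (gaugePair (scShift d L mv kk hL) (fun μ x => coordMat e (ContinuousLinearMap.mulLeftRight ℝ (Matrix mm mm ℂ) (U μ x) (U μ x)ᴴ))) + P) ∘ₗ mmulOp (fun x => (coordMat e (ContinuousLinearMap.mulLeftRight ℝ (Matrix mm mm ℂ) (u' k (kingSec (cvM d L mv kk hL) L kk r x)) (u'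 k (kingSec (cvM d L mv kk hL) L kk r x))ᴴ))ᵀ)) (fun p : ScX d L mv kk hL × ι => scH d L mv
      kk hL k p.1) ∘ₗ (projO none ∘ₗ bgPropV (stack (mulOp (fun p : ScX d L mv kk hL × ι => scBump d L mv kk hL k p.1) ∘ₗ (scCube d L mv kk hL (aK a₀ (L : ℝ) kk * (((L ^ kk : ℕ) : ℝ)) ^ (d + 1)) ι k)) (fun j => Sum.elim (fun μ => fgrad η⁻¹ (liftEquiv (scShift d L mv kk hL μ) ι)) (fun μ => bgrad η⁻¹ (liftEquiv (scShift d L mv kk hL μ) ι)) j ∘ₗ (mulOp (fun p : ScX d L mv kk hL × ι => scBump d L mv kk hL k p.1) ∘ₗ (scCube d L mv kk hL (aK a₀ (L : ℝ) kk * (((L ^ kk : ℕ) : ℝ)) ^ (d + 1)) ι k)))) (mulOp (fun p : ScX d L mv kk hL × ι => scPsi d L mv kk hL k p.1) ∘ₗ (unstackM (tCoefC η (gaugePair (scShift d L mv kk hL) fun μ x => coordMat e (ContinuousLinearMap.mulLeftRight ℝ (Matrix mm mm ℂ) (u' k (kingSec (cvM d L mv kk hL) L kk r x) * U μ x * (u'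 k (kingSec (cvM d L mv kk hL) L kk r (scShift d L mv kk hL μ x)))ᴴ) (u' k (kingSec (cvM d L mv kk hL) L kk r x) * U μ x * (u' k (kingSec (cvM d L mv
      kk hL) L kk r (scShift d L mv kk hL μ x)))ᴴ)ᴴ))) (tCoefA η (gaugePair (scShift d L mv kk hL) fun μ x => coordMat e (ContinuousLinearMap.mulLeftRight ℝ (Matrix mm mm ℂ) (u' k (kingSec (cvM d L mv kk hL) L kk r x) * U μ x * (u' k (kingSec (cvM d L mv kk hL) L kk r (scShift d L mv kk hL μ x)))ᴴ) (u' k (kingSec (cvM d L mv kk hL) L kk r x) * U μ x * (u' k (kingSec (cvM d L mv kk hL) L kk r (scShift d L mv kk hL μ x)))ᴴ)ᴴ))) + NV k ∘ₗ projO none) ∘ₗ mulOp (fun q : (ScX d L mv kk hL × ι) × Option (Fin (d + 1) ⊕ Fin (d + 1)) => scChi d L mv kk hL k q.1.1))) := fun k => mulOp_comp_commOp_conj_comp_of_support (fun x => coordMat e (ContinuousLinearMap.mulLeftRight ℝ (Matrix mm mm ℂ) (u' k (kingSec (cvM d L mv kk hL) L kk r x)) (u' k (kingSec (cvM d L mv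 kk hL) L kk r x))ᴴ)) (fun x => (coordMat e (ContinuousLinearMap.mulLeftRight ℝ (Matrix mm mm ℂ) (u' k (kingSec (cvM d L mv kk hL) L kk r x)) (u' k (kingSec (cvM d L mv kk hL) L kk r x))ᴴ))ᵀ) _ (fun x hx => (scPsi_near_scChi hM hmg₂ hfg₂ hS0 0 k (hhχ k x hx)).1) (mulOp_comp_add_comp_mulOp_eq_zero (mulOp_one_sub_scPsi_comp_covLapM_comp_mulOp_scH ι hM hmg₂ hfg₂ hS0 η _ k (hhχ k)) (hPloc k))
  have hSin : ∀ k x' i, ∑ j, |(scPsi' d L mv kk r hL k x' • ((kingStairT (cvM d L mv kk hL) (L ^ r * L ^ kk) (L ^ r) (fun μ b => coordMat e (ContinuousLinearMap.mulLeftRight ℝ (Matrix mm mm ℂ) (u' k b.1 * U' μ b.1 * (u' k (b.1 + unitVec (fine (L ^ r * L ^ kk) (cvM d L mv kk hL)) μ))ᴴ) (u' k b.1 * U' μ b.1 * (u' k (b.1 + unitVec (fine (L ^ r * L ^ kk) (cvM d L mv kk hL)) μ))ᴴ)ᴴ)) (x', 0))ᵀ - 1)) i j| ≤ sS := fun k x'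 i => smear_cols_kingStairT_coordMat_Ad_transpose_sub_one_le (cvM d L mv kk hL) L kk r e hLr (u' k) U' hρ0 (cvSk d L mv kk hL k) (hρ k) (ψ := scPsi' d L mv kk r hL k) (fun x' => abs_chiCube_le_one _ _) (fun x' hx => by rw [← blockOf_kingPr (cvM d L mv kk hL) L kk r x']; exact scBlk_kingPr_mem_cvSk_of_scPsi'_ne_zero hx) x' i
  have hSout : ∀ k x' i, ∑ j, |(scPsi d L mv kk hL k ((kingPr L kk r (cvM d L mv kk hL)) x') • ((kingStairT (cvM d L mv kk hL) (L ^ r * L ^ kk) (L ^ r) (fun μ b => coordMat e (ContinuousLinearMap.mulLeftRight ℝ (Matrix mm mm ℂ) (u' k b.1 * U' μ b.1 * (u' k (b.1 + unitVec (fine (L ^ r * L ^ kk) (cvM d L mv kk hL)) μ))ᴴ) (u' k b.1 * U' μ b.1 * (u' k (b.1 + unitVec (fine (L ^ r * L ^ kk) (cvM d L mv kk hL)) μ))ᴴ)ᴴ)) (x', 0))ᵀ - 1)) i j| ≤ sS := fun k x' i => smear_cols_kingStairT_coordMat_Ad_transpose_sub_one_le_kingPr (cvM d L mv kk hL) L kk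 r e hLr (u' k) U' hρ0 (cvSk d L mv kk hL k) (hρ k) (ψo := scPsi d L mv kk hL k) (fun x => abs_chiCube_le_one _ _) (fun x hx => scBlk_mem_cvSk_of_scPsi_ne_zero hx) x' i
  -- 335 at the cover
  have key := uN_hasMaj_idef_glueInv_smoothCutDressed_localGauges_tr (X := ScX d L mv kk hL) (X' := ScX' d L mv kk r hL) (ι := ι) (J := Fin (d + 1)) (K := Fin (d + 1) → ZMod (2 * L))
    (g := unitTorusGeo L kk (cvM d L mv kk hL)) (scBlk d L mv kk hL) (kingPr L kk r (cvM d L mv kk hL)) (kingSec (cvM d L mv kk hL) L kk r) (scShift d L mv kk hL) (scShift' d L mv kk r hL)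
    (T := ctauS (cvM d L mv kk hL) L kk r (fun μ x' => coordMat e (ContinuousLinearMap.mulLeftRight ℝ (Matrix mm mm ℂ) (U' μ x') (U' μ x')ᴴ)))
    (St := fun k x' => kingStairT (cvM d L mv kk hL) (L ^ r * L ^ kk) (L ^ r) (fun μ b => coordMat e (ContinuousLinearMap.mulLeftRight ℝ (Matrix mm mm ℂ) (u' k b.1 * U' μ b.1 * (u' k (b.1 + unitVec (fine (L ^ r * L ^ kk) (cvM d L mv kk hL)) μ))ᴴ) (u' k b.1 * U' μ b.1 * (u' k (b.1 + unitVec (fine (L ^ r * L ^ kk) (cvM d L mv kk hL)) μ))ᴴ)ᴴ)) (x', 0))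
    (Ψ := fun x' => kingStairT (cvM d L mv kk hL) (L ^ r * L ^ kk) (L ^ r) (fun μ b => coordMat e (ContinuousLinearMap.mulLeftRight ℝ (Matrix mm mm ℂ) (U' μ b.1) (U' μ b.1)ᴴ)) (x', 0))
    (N := scCube d L mv kk hL (aK a₀ (L : ℝ) kk * (((L ^ kk : ℕ) : ℝ)) ^ (d + 1)) ι) (N' := scCube' d L mv kk r hL (aK a₀ (L : ℝ) (r + kk) * (((L ^ r * L ^ kk : ℕ) : ℝ)) ^ (d + 1)) ι)
    (NL := scQQ d L mv kk hL (aK a₀ (L : ℝ) kk * (((L ^ kk : ℕ) : ℝ)) ^ (d + 1)) ι) (NL' := scQQ' d L mv kk r hL (aK a₀ (L : ℝ) (r + kk) * (((L ^ r * L ^ kk : ℕ) : ℝ)) ^ (d + 1)) ι)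
    (χX := scChi d L mv kk hL) (χtX := scBump d L mv kk hL) (ψX := scPsi d L mv kk hL) (hX := scH d L mv kk hL) (ψo := scPsi d L mv kk hL)
    (χX' := scChi' d L mv kk r hL) (χtX' := scBump' d L mv kk r hL) (ψX' := scPsi' d L mv kk r hL) (hX' := scH' d L mv kk r hL)
    (Sk := cvSk d L mv kk hL) (hb := coverHb (cvM d L mv kk hL) (L ^ kk) (L ^ mv) L) (σ := δm / 32) (cr := cr) (β := β) (β₁ := β₁) (ct := π / W) (m₀ := C * εk) (m₁ := C * εk) (oχ := π * (d + 1) / (((L ^ kk : ℕ) : ℝ) * W)) (oχ₁ := 2 * (π * (d + 1) / (((L ^ kk : ℕ) : ℝ) * W))) (oχ₂ := (W)⁻¹ * (((L ^ kk : ℕ) : ℝ) * W)⁻¹ * (32 * π ^ 4 + π ^ 2 * (d + 1))) (δ := δm) (ρ₁ := δm / 2) (ρ₂ := δm / 4) (ρ₃ := δm / 8) (ρN := δm - δm / 2) (ρT := δm / 2) (δV := δm) (ε := δm / 2) (R := R) (o := o) (c₁ := π / W) (c₂ := 32 * π ^ 2 / W ^ 2) (o₁ := O1) (o₂ := O2)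 (rW := 0) (θW := 0) (cN := (π * (d + 1) / W * 0 + 2 * (π * (d + 1) / W)) * a₀) (rN := RNK) (ℓ := π * (d + 1) / W) (ω := π * (d + 1) / W) (d₁ := 1) (oo := π * (d + 1) / (((L ^ kk : ℕ) : ℝ) * W)) (ε₀ := 0) (rF := 0) (Nov := Nov) (s := sS)
    (rV := rV) (RN := RN) (θF := θ₀) (ρF := δm) (rD := rD) (oV := oV) (oN := oN) (η := η) (η' := η')
    (htri := triangle254_unitTorusGeo L kk _) (hd := unitTorusGeo_dist_nonneg L kk _) (hd0 := unitTorusGeo_dist_self L kk _) (hsymm := unitTorusGeo_dist_symm L kk _) (hrow := hrow) (hσ := by positivity) (hcr := hcr0) (hβ := hC.le) (hβ₁ := hC.le) (hct := div_nonneg pi_pos.le hWpos.le) (hm₀ := mul_nonneg hC.le hεk0) (hm₁ := mul_nonneg hC.le hεk0) (hoχ := hoχ0) (hoχ₁ := mul_nonneg zero_le_two hoχ0) (hoχ₂ := hoχ₂0) (hR := hR0.le) (ho := ho0) (hσρ := by linarith only [hδm0]) (hρ₁V := by linarith only [hδm0]) (hρ₁G := by linarith only [hδm0]) (hρ₂ :=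 by positivity) (hρ₂₁ := by linarith only [hδm0]) (hρ₂T := by linarith only [hδm0]) (hρ₃ := by positivity) (hρ₃₂ := by linarith only [hδm0]) (hρ₃V := by
    linarith only [hδm0]) (hρ₃N := by linarith only [hδm0]) (hσρ₃ := by linarith only [hδm0]) (hε := by positivity) (hc₁ := div_nonneg pi_pos.le hWpos.le) (hc₂ := div_nonneg (by positivity) (pow_nonneg hWpos.le 2)) (ho₁ := ho₁0) (ho₂ := ho₂0) (hrW := le_rfl) (hθW := le_rfl) (hcN := by positivity) (hrN := hRNK0) (hℓ := div_nonneg (by positivity) hWpos.le) (hω := div_nonneg (by positivity) hWpos.le) (hd₁ := zero_le_one) (hoo := hoχ0) (hε₀ := le_rfl) (hrF := le_rfl) (hNov := hNov0) (hn := by rw [hηinv]; exact hnr) (hn' := by rw [hη'inv]; exact hnr') (hSχ := fun k x hx => scBlk_mem_cvSk_of_scChi_ne_zero hM hm₁ hfitI hS0 hx) (hSψ := fun k x hx => scBlk_mem_cvSk_of_scPsi_ne_zero hx) (hSχ' := fun k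
    x' hx => scBlk_kingPr_mem_cvSk_of_scChi'_ne_zero hM hm₁ hfitI hS0 hx) (hSψ' := fun k x' hx => scBlk_kingPr_mem_cvSk_of_scPsi'_ne_zero hx) (hχt := fun k x => abs_bcube_le_one (2 * L) (scXi d L mv kk hL) 2 k x) (hdχt := hdχt) (hdχtb := hdχtb) (hsub := hsub) (hχ := hχ) (hs := hs) (hsb := hsb) (hdd := hdd) (hddb := hddb) (hNψ := hNψ) (hχt' := fun k x => abs_bcube_le_one (2 * L) (scXi' d L mv kk r hL) 2 k x) (hdχt' := hdχt') (hdχtb' := hdχtb') (hsub' := hsub') (hχ' := hχ') (hs' := hs') (hsb' := hsb') (hdd' := hdd') (hddb' := hddb') (hNψ' := hNψ') (hfitχ := hfitχ) (hfit₁ := hfit₁) (hfit₁b := hfit₁b) (hfit₂ := hfit₂) (hfit₂b := hfit₂b) (hcut := hcut) (hcutF := hcutF) (hcutB := hcutB) (hcut' := hcut') (hcutF' := hcutF') (hcutB' := hcutB') (hDcut := hDcut) (hDcutF := hDcutF) (hDcutB := hDcutB) (hs2 := hs2) (hsb2 := hsb2) (hdd2 := hdd2) (hddb2 := hddb2) (hs2'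 := hs2') (hsb2' := hsb2') (hdd2' := hdd2') (hddb2' := hddb2') (hq := hq₀.trans_lt (by norm_num)) (hh1 := hh1) (hh1b := hh1b) (hh1' := hh1') (hh1b' := hh1b') (hh2' := hh2') (hf1 := hf1) (hf1b := hf1b) (hf2 := hf2) (hLip := hLip) (hrh := hrh) (hrh' := hrh') (hfh := hfh) (hstep := fun μ x => tdistT_scBlk_scShift_le μ x) (hstep' := fun μ x' => dist_scBlk_kingPr_scShift'_le μ x') (hKN' := hKN') (hDKN := hDKN) (hh2 := hh2) (hKN := hKN) (hhabs := fun k x => abs_hcube_le_one (2 * L) (scXi d L mv kk hL) k x) (hhabs' := fun k x =>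
    abs_hcube_le_one (2 * L) (scXi' d L mv kk r hL) k x) (hhcut := hhcut) (hhcut' := hhcut') (hN := hN) (hT := hT) (hT' := hT') (hDT := hDT) (he := he) (hu' := hu') (hrV := hrV) (hRN := hRN) (hθF := hθ₀0.le) (hρF := by linarith only [hδm0]) (hrD := hrD) (hoV := hoV) (hoN := hoN) (hRle := hRle) (hole := hole) (hP := hP) (hP' := hP') (hχ1 := fun k x => abs_chiCube_le_one _ _) (hχ1' := fun k x => abs_chiCube_le_one _ _) (hψχ := hψχ) (hψχ' := hψχ') (hCloc := hCloc) (hAloc := hAloc) (hCloc' := hCloc') (hAloc' := hAloc') (hfitC := hfitC) (hfitA := hfitA) (hNVcut := hNVcut) (hNVcut' := hNVcut') (hDNV := hDNV) (hfarN := hfarN) (hfarN' := hfarN') (hDfarN := hDfarN) (hhψ := hhψ) (hχh := hχh) (hhs' := hhs') (hhsb' := hhsb') (hhdd' := hhdd') (hhddb' := hhddb') (hhψf := hhψf) (hχhf := hχhf) (hhsf := hhsf) (hhsbf := hhsbf) (hhddf := hhddf) (hhddbf := hhddbf) (hTk := hTk) (hT0 := rfl) (hΨ := hΨ) (hs0 :=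 hsS0) (hψoχ := hψχ) (hψoh := hψoh) (hKout := hKout) (hSin := hSin) (hSout := hSout) (hq' := hsmall.1)
  have hsm := cvSmall335 (s := sS) (Nov := Nov) (cι2 := cι2) (cι := (Fintype.card ι : ℝ)) (cJ := (Fintype.card (Fin (d + 1)) : ℝ)) (β := β) (β₁ := β₁) (ct := π / W) (R := R) (cr := cr) (c₁ := π / W) (c₂ := 32 * π ^ 2 / W ^ 2) (θW := 0) (cN := (π * (d + 1) / W * 0 + 2 * (π * (d + 1) / W)) * a₀) (ℓ := π * (d + 1) / W) (ε := δm / 2) (ω := π * (d + 1) / W) (d₁ := 1) (θF := θ₀) (ε₀ := 0) (m₀ := C * εk) (m₁ := C * εk) (oχ := π * (d + 1) / (((L ^ kk : ℕ) : ℝ) * W)) (oχ₁ := 2 * (π * (d + 1) / (((L ^ kk : ℕ) : ℝ) * W))) (oχ₂ := (W)⁻¹ * (((L ^ kk : ℕ) : ℝ) * W)⁻¹ * (32 * π ^ 4 + π ^ 2 * (d + 1))) (o := o) (o₁ := O1) (o₂ := O2) (rW := 0) (rN := RNK) (oo := π * (d + 1) / (((L ^ kk : ℕ) : ℝ) * W))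 (rF := 0) (rD := rD) (η := η)
    (η' := η') (S := Sdef) (ctb := π) (c₁b := π) (c₂b := 32 * π ^ 2) (cNb := (π * (d + 1) * 0 + 2 * (π * (d + 1))) * a₀) (ε₀b := 0) (θFb := θ₀) (LRb := π * (d + 1) * E' + 2 * (π * (d + 1) + π * (d + 1) * 1)) (ks := 1) (km₀ := C) (km₁ := C) (koχ := π * (d + 1)) (koχ₁ := 2 * (π * (d + 1))) (koχ₂ := 32 * π ^ 4 + π ^ 2 * (d + 1)) (ko := 1) (ko₁ := 64 * π ^ 2 + π ^ 2 * Fintype.card (Fin (d + 1))) (ko₂ := 144 * π ^ 3 + 32 * π ^ 3 * Fintype.card (Fin (d + 1))) (krW := 0) (krN := KRN) (koo := π * (d + 1)) (krF := 0) (krD := 1) (kη0 := π) (kη1 := π)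
    hNov0 hcι20 (Nat.cast_nonneg _) (Nat.cast_nonneg _) hβ0 hβ₁0 hR0.le hcr0 le_rfl (div_nonneg pi_pos.le hWpos.le) (div_le_self pi_pos.le hW1) (div_nonneg pi_pos.le hWpos.le) (div_le_self pi_pos.le hW1) (div_nonneg (by positivity) (pow_nonneg hWpos.le 2)) (div_le_self (by positivity) (by nlinarith only [hW1])) (by positivity) hcNb le_rfl le_rfl hθ₀0.le le_rfl (cv_inv_le_two hq₀).1 (cv_inv_le_two hq₀).2 (cv_inv_le_two' hq₀).1 (cv_inv_le_two' hq₀).2 hLR20 hLRb2 hhalf.1 hhalf.2 hsS0 hss (mul_nonneg hC.le hεk0) hsm₀ (mul_nonneg hC.le hεk0) hsm₀ hoχ0 hsoχ (mul_nonneg zero_le_two hoχ0) hsoχ₁ hoχ₂0 hsoχ₂ ho0 hso ho₁0 hso₁ ho₂0 hso₂ le_rfl (by rw [zero_mul]) hRNK0 hsRN hoχ0 hsoχ le_rfl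
    (by rw [zero_mul]) hrD hsrD (div_nonneg (div_nonneg pi_pos.le hWpos.le) (inv_nonneg.mpr hη0)) hsDη0 (div_nonneg (div_nonneg pi_pos.le hWpos.le) (inv_nonneg.mpr hη'0)) hsDη1
  refine key.mono fun y y' => ?_
  exact mul_le_mul hsm.2 (Real.exp_le_exp.mpr (le_of_eq (by ring))) (Real.exp_nonneg _) (hsm.1.trans hsm.2)

end Knit

end Summit.QuantumFields.YangMills.BalabanUVNodes.N15.Gluing

end
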